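import Literature.Analysis.FluidPDE.DivFreeL3Approximation
import Literature.Analysis.FluidPDE.LocalPressureFarFieldTools
import Literature.Analysis.FluidPDE.LocalEnergySolutionsOn
import Literature.Analysis.FluidPDE.EnstrophySplitting
import HarnessLib

/-!
# Splitting of divergence-free `L³_uloc` data vanishing at infinity (uniformly local estimates of
# the Newtonian gradient corrector)

Analysis/FluidPDE theorem file (no definitions, no named facts). Main result:
`exists_uloc_solenoidal_splitting` — a weakly divergence-free field `a` with
`sup_{x₀} ∫_{B(x₀,1)} |a|³ < ∞` and `∫_{B(x₀,1)} |a|³ → 0` (`|x₀| → ∞`) is approximated in `L²_loc`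
by divergence-free fields `α_k + β_k ∈ L² ∩ L³ ∩ L^∞` with `α_k` uniformly small in `L³_uloc` and
`β_k` bounded in `L²` (the data splitting of Lemarié-Rieusset 2016, Thm. 14.8, proof, Step 2 /
Seregin 2014, App. B §B.5). It rests on estimates for the first-derivative Newtonian potential
`T_a g (x) = ∫ ∂_aΓ(x − y) g(y) dy` (`newtonGradPotential`, the building block of the
divergence-free truncation of `DivFreeL3Approximation.lean`) of a source `g` supported in a ball
`B̄(0, ρ)`:

* `lintegral_ball_inv_one_add_sq_le` — `∫_{B(0,r)} (1 + |x − z|²)⁻¹ dz ≤ r (|B₁| + 12π)` for every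
  `x` (a weight integral growing only linearly with the radius);
* `exists_lintegral_unitBall_newtonGradPotential_cube_le` — the **uniformly local `L³` bound**
  `∫_{B(z,1)} |T_a g|³ ≤ K |a|³ (Γ₃ + (ρ Γ₁)³)` in terms of the uniformly local sizes
  `Γ₃ = sup_c ∫_{B(c,1)} |g|³`, `Γ₁ = sup_c ∫_{B(c,1)} |g|` (near part: Young on `B(z,2)` with the
  kernel `1_{|w|<1}|w|⁻²`; far part: the tree's averaging lemma
  `lintegral_mul_le_of_forall_lintegral_ball_le` with the weight `8(1+|x−z|²)⁻¹ 1_{B(0,ρ+1)}`);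
* `exists_lintegral_newtonGradPotential_sq_le` — the **`L²` bound**
  `∫ |T_a g|² ≤ |a|² K_R (∫|g|² + (∫|g|)²)` for `supp g ⊆ B̄(0, 2R)` (the constants of the tree's
  `memLp_two_newtonGradPotential` made explicit).

and on the locality of mollification for uniformly locally `L³` fields
(`lintegral_ball_cube_normed_convolution_le`, `tendsto_lintegral_ball_normed_convolution_sub_sq`);
`exists_lintegral_unitBall_newtonCorrector_cube_le` is the uniformly local smallness of the
corrector of the truncation at radius `R` in terms of the size of the field on `‖x‖ ≥ R - 1`
(where the decay at infinity enters). These serve the extension step of the local energy theory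
(Lemarié-Rieusset 2016, Thm. 14.8, proof, Step 2: "`β ∈ E³_{comp,σ}`, `α` small in `E³_σ`";
Seregin 2014, App. B §B.5: "using density of smooth functions, let us decompose
`v(·,t₀) = a₁ + a₂`").

## References

* D. Gilbarg, N. S. Trudinger (2001), Lemma 4.1 with (4.9). [GilbargTrudinger2001]
* P. G. Lemarié-Rieusset (2016), Thm. 14.8, proof, Step 2. [LemarieRieusset2016]
* G. Seregin (2014), App. B §B.5. [Seregin2014Notes]
-/

noncomputable section

open MeasureTheory TopologicalSpace Set Function Filter Topology Metric Real
open scoped ENNReal NNReal RealInnerProductSpace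

namespace Literature.Analysis.FluidPDE

/-! ### The weight integral -/

/-- **The weight integral grows linearly**: for `r > 0` and every `x`,
`∫_{B(0,r)} (1 + ‖x − z‖²)⁻¹ dz ≤ r (|B₁| + 12π)` (if `‖x‖ ≥ 2r` the integrand is `≤ r⁻²` on the
ball, of volume `r³|B₁|`; otherwise `B(0,r) ⊆ B(x,3r)` and `(1+s)⁻¹ ≤ s⁻¹`, `∫_{|w|<3r}|w|⁻² = 12πr`).
[folklore] -/
theorem lintegral_ball_inv_one_add_sq_le {r : ℝ} (hr : 0 < r) (x : EuclideanSpace ℝ (Fin 3)) :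
    ∫⁻ z in ball (0 : EuclideanSpace ℝ (Fin 3)) r, ENNReal.ofReal ((1 + ‖x - z‖ ^ 2)⁻¹) ≤
      ENNReal.ofReal r * (volume (ball (0 : EuclideanSpace ℝ (Fin 3)) 1) + ENNReal.ofReal (12 * π)) := by
  have hE : Module.finrank ℝ (EuclideanSpace ℝ (Fin 3)) = 3 := by simp
  by_cases hx : 2 * r ≤ ‖x‖
  · -- far centre: the integrand is `≤ r⁻²`
    have hpt : ∀ z ∈ ball (0 : EuclideanSpace ℝ (Fin 3)) r,
        ENNReal.ofReal ((1 + ‖x - z‖ ^ 2)⁻¹) ≤ ENNReal.ofReal ((r ^ 2)⁻¹) := by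
      intro z hz
      rw [mem_ball_zero_iff] at hz
      refine ENNReal.ofReal_le_ofReal (inv_anti₀ (by positivity) ?_)
      have h1 : r ≤ ‖x - z‖ := by
        have := norm_sub_norm_le x z
        linarith
      nlinarith
    calc ∫⁻ z in ball (0 : EuclideanSpace ℝ (Fin 3)) r, ENNReal.ofReal ((1 + ‖x - z‖ ^ 2)⁻¹)
        ≤ ∫⁻ _ in ball (0 : EuclideanSpace ℝ (Fin 3)) r, ENNReal.ofReal ((r ^ 2)⁻¹) :=
          setLIntegral_mono' measurableSet_ball hpt
      _ = ENNReal.ofReal ((r ^ 2)⁻¹) * (ENNReal.ofReal (r ^ 3) * volume (ball (0 : EuclideanSpace ℝ (Fin 3)) 1)) := by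
          rw [setLIntegral_const, Measure.addHaar_ball_of_pos volume _ hr, hE]
      _ = ENNReal.ofReal r * volume (ball (0 : EuclideanSpace ℝ (Fin 3)) 1) := by
          rw [← mul_assoc, ← ENNReal.ofReal_mul (by positivity)]
          congr 2
          field_simp
      _ ≤ _ := by gcongr; exact le_self_add
  · -- near centre: `B(0,r) ⊆ B(x,3r)` and `(1+s)⁻¹ ≤ s⁻¹`
    rw [not_le] at hx
    have hsub : ball (0 : EuclideanSpace ℝ (Fin 3)) r ⊆ ball x (3 * r) := fun z hz => by
      rw [mem_ball_zero_iff] at hz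
      rw [mem_ball, dist_eq_norm]
      calc ‖z - x‖ ≤ ‖z‖ + ‖x‖ := norm_sub_le _ _
        _ < 3 * r := by linarith
    have hae : ∀ᵐ z ∂(volume.restrict (ball x (3 * r))),
        ENNReal.ofReal ((1 + ‖x - z‖ ^ 2)⁻¹) ≤ ENNReal.ofReal (nearProfile₂ (3 * r) ‖x - z‖) := by
      have hne : ∀ᵐ z ∂(volume : Measure (EuclideanSpace ℝ (Fin 3))), z ≠ x := by
        rw [ae_iff]
        have : {z : EuclideanSpace ℝ (Fin 3) | ¬ z ≠ x} = {x} := by ext z; simp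
        rw [this, measure_singleton]
      filter_upwards [ae_restrict_mem measurableSet_ball, ae_restrict_of_ae hne] with z hz hzx
      have hxz : 0 < ‖x - z‖ := norm_pos_iff.2 (sub_ne_zero.2 (Ne.symm hzx))
      have hlt : ‖x - z‖ < 3 * r := by rw [← dist_eq_norm, dist_comm]; exact mem_ball.1 hz
      unfold nearProfile₂
      rw [if_pos hlt]
      exact ENNReal.ofReal_le_ofReal (inv_anti₀ (by positivity) (by linarith))
    calc ∫⁻ z in ball (0 : EuclideanSpace ℝ (Fin 3)) r, ENNReal.ofReal ((1 + ‖x - z‖ ^ 2)⁻¹)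
        ≤ ∫⁻ z in ball x (3 * r), ENNReal.ofReal ((1 + ‖x - z‖ ^ 2)⁻¹) := lintegral_mono_set hsub
      _ ≤ ∫⁻ z in ball x (3 * r), ENNReal.ofReal (nearProfile₂ (3 * r) ‖x - z‖) := lintegral_mono_ae hae
      _ ≤ ∫⁻ z, ENNReal.ofReal (nearProfile₂ (3 * r) ‖x - z‖) := setLIntegral_le_lintegral _ _
      _ = ∫⁻ z, ENNReal.ofReal (nearProfile₂ (3 * r) ‖z‖) :=
          lintegral_sub_left_eq_self (fun z : EuclideanSpace ℝ (Fin 3) => ENNReal.ofReal (nearProfile₂ (3 * r) ‖z‖)) x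
      _ = ENNReal.ofReal (4 * π * (3 * r)) := lintegral_nearProfile₂_norm (by positivity)
      _ = ENNReal.ofReal r * ENNReal.ofReal (12 * π) := by
          rw [← ENNReal.ofReal_mul hr.le]; congr 1; ring
      _ ≤ _ := by gcongr; exact le_add_self

/-! ### The uniformly local `L³` bound -/

/-- The far weight is dominated on unit distance: if `1 ≤ ‖x - y‖` and `dist z y < 1` then
`(‖x−y‖²)⁻¹ ≤ 8 (1 + ‖x − z‖²)⁻¹`. [folklore] -/
theorem inv_sq_le_eight_mul_inv_one_add_sq {x y z : EuclideanSpace ℝ (Fin 3)} (hxy : 1 ≤ ‖x - y‖)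
    (hzy : dist z y < 1) : (‖x - y‖ ^ 2)⁻¹ ≤ 8 * (1 + ‖x - z‖ ^ 2)⁻¹ := by
  have hxz : ‖x - z‖ ≤ ‖x - y‖ + 1 := by
    calc ‖x - z‖ = ‖(x - y) + (y - z)‖ := by rw [sub_add_sub_cancel]
      _ ≤ ‖x - y‖ + ‖y - z‖ := norm_add_le _ _
      _ ≤ ‖x - y‖ + 1 := by
          refine add_le_add le_rfl ?_
          rw [norm_sub_rev, ← dist_eq_norm]; exact hzy.le
  have h1 : 1 + ‖x - z‖ ^ 2 ≤ 8 * ‖x - y‖ ^ 2 := by nlinarith [norm_nonneg (x - z)]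
  rw [← div_eq_mul_inv, le_div_iff₀ (by positivity)]
  calc (‖x - y‖ ^ 2)⁻¹ * (1 + ‖x - z‖ ^ 2) ≤ (‖x - y‖ ^ 2)⁻¹ * (8 * ‖x - y‖ ^ 2) := by gcongr
    _ = 8 := by field_simp

/-- **The uniformly local `L³` bound for the Newtonian gradient potential.** There is a universal
`K < ∞` such that for every continuous `g` vanishing off `B̄(0, ρ)`, `ρ ≥ 1`, with
`∫_{B(c,1)} |g|³ ≤ Γ₃` and `∫_{B(c,1)} |g| ≤ Γ₁` for every centre `c`, every direction `a` and every
centre `z`: `∫_{B(z,1)} |T_a g|³ ≤ K |a|³ (Γ₃ + (ρ Γ₁)³)`. Proof: `|T_a g(x)| ≤ |a|(4π)⁻¹ (N(x) + F(x))`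
with the near part `N = |g 1_{B(z,2)}| ⋆ 1_{|w|<1}|w|⁻²` on `B(z,1)` (Young, `∫ 1_{|w|<1}|w|⁻² = 4π`,
and `B(z,2)` is covered by boundedly many unit balls) and the far part
`F(x) = ∫_{|x−y|≥1} |g(y)| |x−y|⁻² dy ≤ |B₁|⁻¹ Γ₁ ∫_{B(0,ρ+1)} 8(1+|x−z'|²)⁻¹ dz' ≲ ρ Γ₁`
(averaging lemma). [cite: GilbargTrudinger2001, Lemma 4.1 with (4.9)] -/
theorem exists_lintegral_unitBall_newtonGradPotential_cube_le :
    ∃ K : ℝ≥0∞, K < ⊤ ∧ ∀ (g : EuclideanSpace ℝ (Fin 3) → ℝ) (a : EuclideanSpace ℝ (Fin 3)) (ρ : ℝ)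
      (Γ₁ Γ₃ : ℝ≥0∞), Continuous g → 1 ≤ ρ → (∀ y, g y ≠ 0 → ‖y‖ ≤ ρ) →
      (∀ c : EuclideanSpace ℝ (Fin 3), ∫⁻ y in ball c 1, ‖g y‖ₑ ^ (3 : ℕ) ≤ Γ₃) →
      (∀ c : EuclideanSpace ℝ (Fin 3), ∫⁻ y in ball c 1, ‖g y‖ₑ ≤ Γ₁) →
      ∀ z : EuclideanSpace ℝ (Fin 3),
        ∫⁻ x in ball z 1, ‖newtonGradPotential a g x‖ₑ ^ (3 : ℕ) ≤
          K * ‖a‖ₑ ^ (3 : ℕ) * (Γ₃ + (ENNReal.ofReal ρ * Γ₁) ^ (3 : ℕ)) := by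
  -- ## the constants
  obtain ⟨F₂, hF₂⟩ := exists_finset_ball_subset_biUnion_ball_one (2 : ℝ)
  set V : ℝ≥0∞ := volume (ball (0 : EuclideanSpace ℝ (Fin 3)) 1) with hV
  have hV0 : V ≠ 0 := (measure_ball_pos volume _ one_pos).ne'
  have hVt : V ≠ ⊤ := measure_ball_lt_top.ne
  set Kw : ℝ≥0∞ := V + ENNReal.ofReal (12 * π) with hKw
  have hKwt : Kw ≠ ⊤ := ENNReal.add_ne_top.2 ⟨hVt, ENNReal.ofReal_ne_top⟩
  set c₀ : ℝ≥0∞ := ENNReal.ofReal (4 * π)⁻¹ with hc₀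
  -- near constant `(4π)³ |F₂|`, far constant `V (V⁻¹ · 8 · 2 Kw)³`
  set Kn : ℝ≥0∞ := ENNReal.ofReal (4 * π * 1) ^ (3 : ℕ) * (F₂.card : ℝ≥0∞) with hKn
  set Kf : ℝ≥0∞ := V * (V⁻¹ * (8 * (2 * Kw))) ^ (3 : ℕ) with hKf
  have hKnt : Kn ≠ ⊤ := ENNReal.mul_ne_top (ENNReal.pow_ne_top ENNReal.ofReal_ne_top) (ENNReal.natCast_ne_top _)
  have hKft : Kf ≠ ⊤ := by
    refine ENNReal.mul_ne_top hVt (ENNReal.pow_ne_top (ENNReal.mul_ne_top (ENNReal.inv_ne_top.2 hV0) ?_))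
    exact ENNReal.mul_ne_top ENNReal.ofNat_ne_top (ENNReal.mul_ne_top ENNReal.ofNat_ne_top hKwt)
  refine ⟨4 * c₀ ^ (3 : ℕ) * (Kn + Kf), ?_, ?_⟩
  · exact ENNReal.mul_lt_top (ENNReal.mul_lt_top ENNReal.ofNat_lt_top (ENNReal.pow_lt_top ENNReal.ofReal_lt_top))
      (ENNReal.add_lt_top.2 ⟨hKnt.lt_top, hKft.lt_top⟩)
  intro g a ρ Γ₁ Γ₃ hg hρ hsupp hΓ₃ hΓ₁ z
  have hρ0 : 0 < ρ := one_pos.trans_le hρ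
  have hGm : Measurable fun y => ‖g y‖ₑ := hg.measurable.enorm
  -- ## the near kernel and the near/far split of the potential bound
  set k₁ : EuclideanSpace ℝ (Fin 3) → ℝ≥0∞ := fun w => ENNReal.ofReal (nearProfile₂ 1 ‖w‖) with hk₁
  have hk₁m : Measurable k₁ := measurable_ofReal_profile_norm (measurable_nearProfile₂ _)
  have hk₁int : ∫⁻ w, k₁ w = ENNReal.ofReal (4 * π * 1) := lintegral_nearProfile₂_norm one_pos
  set Wf : EuclideanSpace ℝ (Fin 3) → EuclideanSpace ℝ (Fin 3) → ℝ≥0∞ := fun x y =>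
    if 1 ≤ ‖x - y‖ then ENNReal.ofReal ((‖x - y‖ ^ 2)⁻¹) else 0 with hWf
  have hsplit : ∀ x y : EuclideanSpace ℝ (Fin 3),
      ENNReal.ofReal ((‖x - y‖ ^ 2)⁻¹) = k₁ (x - y) + Wf x y := by
    intro x y
    simp only [hk₁, hWf]
    unfold nearProfile₂
    by_cases h : ‖x - y‖ < 1
    · rw [if_pos h, if_neg (not_le.2 h), add_zero]
    · rw [if_neg h, if_pos (not_lt.1 h), ENNReal.ofReal_zero, zero_add]
  -- the localized source `g 1_{B(z,2)}` and the near part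
  set Gz : EuclideanSpace ℝ (Fin 3) → ℝ≥0∞ := fun y => (ball z 2).indicator (fun y => ‖g y‖ₑ) y with hGz
  have hGzm : Measurable Gz := hGm.indicator measurableSet_ball
  set N : EuclideanSpace ℝ (Fin 3) → ℝ≥0∞ := fun x => ∫⁻ y, Gz y * k₁ (x - y) with hN
  set Ff : EuclideanSpace ℝ (Fin 3) → ℝ≥0∞ := fun x => ∫⁻ y, ‖g y‖ₑ * Wf x y with hFf
  -- on `B(z,1)` the near kernel only sees `B(z,2)`
  have hnear : ∀ x ∈ ball z 1, ∫⁻ y, ‖g y‖ₑ * k₁ (x - y) = N x := by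
    intro x hx
    refine lintegral_congr fun y => ?_
    simp only [hGz]
    by_cases hy : y ∈ ball z 2
    · rw [indicator_of_mem hy]
    · have hk0 : k₁ (x - y) = 0 := by
        simp only [hk₁]
        unfold nearProfile₂
        rw [if_neg, ENNReal.ofReal_zero]
        intro hlt
        apply hy
        rw [mem_ball] at hx ⊢
        calc dist y z ≤ dist y x + dist x z := dist_triangle _ _ _
          _ < 1 + 1 := by
              refine add_lt_add ?_ hx
              rw [dist_eq_norm, ← norm_neg, neg_sub]; exact hlt
          _ = 2 := by norm_num
      rw [indicator_of_notMem hy, hk0, mul_zero, zero_mul]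
  -- ## the pointwise bound `‖T x‖ ≤ ‖a‖ c₀ (N x + Ff x)` on `B(z,1)`
  have hpt : ∀ x ∈ ball z 1, ‖newtonGradPotential a g x‖ₑ ≤ ‖a‖ₑ * c₀ * (N x + Ff x) := by
    intro x hx
    have h := enorm_newtonGradPotential_le_lintegral a x (g := g)
    refine h.trans (le_of_eq ?_)
    congr 1
    have e : ∀ y, ‖g y‖ₑ * ENNReal.ofReal ((‖x - y‖ ^ 2)⁻¹) = ‖g y‖ₑ * k₁ (x - y) + ‖g y‖ₑ * Wf x y := fun y => by
      rw [hsplit x y, mul_add]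
    simp_rw [e]
    have hm : AEMeasurable (fun y => ‖g y‖ₑ * k₁ (x - y)) volume :=
      (hGm.mul (hk₁m.comp (measurable_const.sub measurable_id))).aemeasurable
    rw [lintegral_add_left' hm, hnear x hx]
  -- ## the near part: Young on `B(z,1)`
  have hYoung : ∫⁻ x in ball z 1, N x ^ (3 : ℝ) ≤ (∫⁻ w, k₁ w) ^ (3 : ℝ) * ∫⁻ y, Gz y ^ (3 : ℝ) := by
    have h32 : (3 / 2 : ℝ).HolderConjugate 3 := by
      rw [Real.holderConjugate_iff]; norm_num
    exact lintegral_rpow_lintegral_mul_kernel_le h32 hGzm hk₁m (ball z 1)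
  have hGz3 : ∫⁻ y, Gz y ^ (3 : ℝ) ≤ (F₂.card : ℝ≥0∞) * Γ₃ := by
    have e : ∀ y, Gz y ^ (3 : ℝ) = (ball z 2).indicator (fun y => ‖g y‖ₑ ^ (3 : ℕ)) y := fun y => by
      simp only [hGz]
      by_cases hy : y ∈ ball z 2
      · rw [indicator_of_mem hy, indicator_of_mem hy, ← ENNReal.rpow_natCast]; norm_num
      · rw [indicator_of_notMem hy, indicator_of_notMem hy, ENNReal.zero_rpow_of_pos (by norm_num)]
    simp_rw [e]
    rw [lintegral_indicator measurableSet_ball]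
    calc ∫⁻ y in ball z 2, ‖g y‖ₑ ^ (3 : ℕ) ≤ ∫⁻ y in ⋃ c ∈ F₂, ball (z + c) 1, ‖g y‖ₑ ^ (3 : ℕ) :=
          lintegral_mono_set (hF₂ z)
      _ ≤ (F₂.card : ℝ≥0∞) * Γ₃ := lintegral_biUnion_finset_le_card_mul F₂ _ _ fun c _ => hΓ₃ (z + c)
  have hNbound : ∫⁻ x in ball z 1, N x ^ (3 : ℕ) ≤ Kn * Γ₃ := by
    have e : ∀ x, N x ^ (3 : ℕ) = N x ^ (3 : ℝ) := fun x => by rw [← ENNReal.rpow_natCast]; norm_num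
    simp_rw [e]
    calc ∫⁻ x in ball z 1, N x ^ (3 : ℝ) ≤ (∫⁻ w, k₁ w) ^ (3 : ℝ) * ∫⁻ y, Gz y ^ (3 : ℝ) := hYoung
      _ ≤ (∫⁻ w, k₁ w) ^ (3 : ℝ) * ((F₂.card : ℝ≥0∞) * Γ₃) := mul_le_mul' le_rfl hGz3
      _ = Kn * Γ₃ := by
          rw [hk₁int, hKn, ← mul_assoc]
          congr 1
          rw [← ENNReal.rpow_natCast]; norm_num
  -- ## the far part: the averaging lemma, uniformly in `x`
  have hFfbound : ∀ x, Ff x ≤ V⁻¹ * (Γ₁ * (8 * (ENNReal.ofReal (ρ + 1) * Kw))) := by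
    intro x
    -- the restricted weight and its majorant
    set W' : EuclideanSpace ℝ (Fin 3) → ℝ≥0∞ := fun y => (closedBall (0 : EuclideanSpace ℝ (Fin 3)) ρ).indicator (Wf x) y
      with hW'
    set w : EuclideanSpace ℝ (Fin 3) → ℝ≥0∞ := fun z' =>
      (ball (0 : EuclideanSpace ℝ (Fin 3)) (ρ + 1)).indicator (fun z' => 8 * ENNReal.ofReal ((1 + ‖x - z'‖ ^ 2)⁻¹)) z'
      with hw
    have hwm : AEMeasurable w volume := by
      refine (Measurable.indicator ?_ measurableSet_ball).aemeasurable
      exact measurable_const.mul ((measurable_const.add ((measurable_const.sub measurable_id).norm.pow_const 2)).inv.ennreal_ofReal)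
    have hgW : ∀ y, ‖g y‖ₑ * Wf x y = ‖g y‖ₑ * W' y := fun y => by
      by_cases hy : y ∈ closedBall (0 : EuclideanSpace ℝ (Fin 3)) ρ
      · simp only [hW', indicator_of_mem hy]
      · have hg0 : g y = 0 := by
          by_contra hne
          exact hy (mem_closedBall_zero_iff.2 (hsupp y hne))
        rw [hg0, enorm_zero, zero_mul, zero_mul]
    have hWw : ∀ y z' : EuclideanSpace ℝ (Fin 3), dist z' y < 1 → W' y ≤ w z' := by
      intro y z' hzy
      by_cases hy : y ∈ closedBall (0 : EuclideanSpace ℝ (Fin 3)) ρ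
      · have hz' : z' ∈ ball (0 : EuclideanSpace ℝ (Fin 3)) (ρ + 1) := by
          rw [mem_ball_zero_iff]
          rw [mem_closedBall_zero_iff] at hy
          calc ‖z'‖ = ‖(z' - y) + y‖ := by rw [sub_add_cancel]
            _ ≤ ‖z' - y‖ + ‖y‖ := norm_add_le _ _
            _ < 1 + ρ := by
                refine add_lt_add_of_lt_of_le ?_ hy
                rw [← dist_eq_norm]; exact hzy
            _ = ρ + 1 := add_comm _ _
        simp only [hW', hw, indicator_of_mem hy, indicator_of_mem hz', hWf]
        by_cases hxy : 1 ≤ ‖x - y‖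
        · rw [if_pos hxy, ← ENNReal.ofReal_ofNat 8, ← ENNReal.ofReal_mul (by norm_num)]
          exact ENNReal.ofReal_le_ofReal (inv_sq_le_eight_mul_inv_one_add_sq hxy hzy)
        · rw [if_neg hxy]; exact zero_le
      · simp only [hW', indicator_of_notMem hy]; exact zero_le
    have hkey := lintegral_mul_le_of_forall_lintegral_ball_le hGm.aemeasurable hwm hΓ₁ hWw
    have hwint : ∫⁻ z', w z' ≤ 8 * (ENNReal.ofReal (ρ + 1) * Kw) := by
      simp only [hw]
      rw [lintegral_indicator measurableSet_ball, lintegral_const_mul' _ _ ENNReal.ofNat_ne_top]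
      exact mul_le_mul' le_rfl (lintegral_ball_inv_one_add_sq_le (by linarith) x)
    calc Ff x = ∫⁻ y, ‖g y‖ₑ * W' y := lintegral_congr hgW
      _ ≤ V⁻¹ * (Γ₁ * ∫⁻ z', w z') := hkey
      _ ≤ V⁻¹ * (Γ₁ * (8 * (ENNReal.ofReal (ρ + 1) * Kw))) := by gcongr
  have hFf3 : ∫⁻ x in ball z 1, Ff x ^ (3 : ℕ) ≤ Kf * (ENNReal.ofReal ρ * Γ₁) ^ (3 : ℕ) := by
    have hρ1 : ENNReal.ofReal (ρ + 1) ≤ 2 * ENNReal.ofReal ρ := by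
      rw [← ENNReal.ofReal_ofNat 2, ← ENNReal.ofReal_mul (by norm_num)]
      exact ENNReal.ofReal_le_ofReal (by linarith)
    have hb : ∀ x, Ff x ≤ (V⁻¹ * (8 * (2 * Kw))) * (ENNReal.ofReal ρ * Γ₁) := fun x => by
      calc Ff x ≤ V⁻¹ * (Γ₁ * (8 * (ENNReal.ofReal (ρ + 1) * Kw))) := hFfbound x
        _ ≤ V⁻¹ * (Γ₁ * (8 * ((2 * ENNReal.ofReal ρ) * Kw))) := by gcongr
        _ = (V⁻¹ * (8 * (2 * Kw))) * (ENNReal.ofReal ρ * Γ₁) := by ring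
    calc ∫⁻ x in ball z 1, Ff x ^ (3 : ℕ)
        ≤ ∫⁻ _ in ball z 1, ((V⁻¹ * (8 * (2 * Kw))) * (ENNReal.ofReal ρ * Γ₁)) ^ (3 : ℕ) :=
          lintegral_mono fun x => pow_le_pow_left' (hb x) 3
      _ = V * ((V⁻¹ * (8 * (2 * Kw))) * (ENNReal.ofReal ρ * Γ₁)) ^ (3 : ℕ) := by
          rw [setLIntegral_const, Measure.addHaar_ball_center volume z 1, mul_comm]
      _ = Kf * (ENNReal.ofReal ρ * Γ₁) ^ (3 : ℕ) := by rw [hKf]; ring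
  -- ## assembling
  have hNm : Measurable N := by
    have hunc : Measurable (uncurry fun x y : EuclideanSpace ℝ (Fin 3) => Gz y * k₁ (x - y)) :=
      (hGzm.comp measurable_snd).mul (hk₁m.comp (measurable_fst.sub measurable_snd))
    exact hunc.lintegral_prod_right'
  have hcube : ∀ p q : ℝ≥0∞, (p + q) ^ (3 : ℕ) ≤ 4 * (p ^ (3 : ℕ) + q ^ (3 : ℕ)) := fun p q => by
    have h := ENNReal.rpow_add_le_mul_rpow_add_rpow p q (by norm_num : (1 : ℝ) ≤ 3)
    have e4 : (2 : ℝ≥0∞) ^ ((3 : ℝ) - 1) = 4 := by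
      rw [show (3 : ℝ) - 1 = ((2 : ℕ) : ℝ) by norm_num, ENNReal.rpow_natCast]; norm_num
    have e3 : ∀ w : ℝ≥0∞, w ^ (3 : ℝ) = w ^ (3 : ℕ) := fun w => by
      rw [show (3 : ℝ) = ((3 : ℕ) : ℝ) by norm_num, ENNReal.rpow_natCast]
    simpa only [e4, e3] using h
  calc ∫⁻ x in ball z 1, ‖newtonGradPotential a g x‖ₑ ^ (3 : ℕ)
      ≤ ∫⁻ x in ball z 1, (‖a‖ₑ * c₀) ^ (3 : ℕ) * (4 * (N x ^ (3 : ℕ) + Ff x ^ (3 : ℕ))) := by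
        refine setLIntegral_mono' measurableSet_ball fun x hx => ?_
        calc ‖newtonGradPotential a g x‖ₑ ^ (3 : ℕ) ≤ (‖a‖ₑ * c₀ * (N x + Ff x)) ^ (3 : ℕ) :=
              pow_le_pow_left' (hpt x hx) 3
          _ = (‖a‖ₑ * c₀) ^ (3 : ℕ) * (N x + Ff x) ^ (3 : ℕ) := by rw [mul_pow]
          _ ≤ (‖a‖ₑ * c₀) ^ (3 : ℕ) * (4 * (N x ^ (3 : ℕ) + Ff x ^ (3 : ℕ))) :=
              mul_le_mul' le_rfl (hcube _ _)
    _ = (‖a‖ₑ * c₀) ^ (3 : ℕ) * (4 * ((∫⁻ x in ball z 1, N x ^ (3 : ℕ)) + ∫⁻ x in ball z 1, Ff x ^ (3 : ℕ))) := by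
        rw [lintegral_const_mul' _ _ (ENNReal.pow_ne_top (ENNReal.mul_ne_top enorm_ne_top ENNReal.ofReal_ne_top)),
          lintegral_const_mul' _ _ ENNReal.ofNat_ne_top,
          lintegral_add_left' ((hNm.pow_const 3).aemeasurable)]
    _ ≤ (‖a‖ₑ * c₀) ^ (3 : ℕ) * (4 * (Kn * Γ₃ + Kf * (ENNReal.ofReal ρ * Γ₁) ^ (3 : ℕ))) := by
        gcongr
    _ ≤ 4 * c₀ ^ (3 : ℕ) * (Kn + Kf) * ‖a‖ₑ ^ (3 : ℕ) * (Γ₃ + (ENNReal.ofReal ρ * Γ₁) ^ (3 : ℕ)) := by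
        have h1 : Kn * Γ₃ + Kf * (ENNReal.ofReal ρ * Γ₁) ^ (3 : ℕ) ≤
            (Kn + Kf) * (Γ₃ + (ENNReal.ofReal ρ * Γ₁) ^ (3 : ℕ)) := by
          calc Kn * Γ₃ + Kf * (ENNReal.ofReal ρ * Γ₁) ^ (3 : ℕ)
              ≤ (Kn + Kf) * Γ₃ + (Kn + Kf) * (ENNReal.ofReal ρ * Γ₁) ^ (3 : ℕ) := by
                gcongr <;> simp
            _ = (Kn + Kf) * (Γ₃ + (ENNReal.ofReal ρ * Γ₁) ^ (3 : ℕ)) := by ring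
        calc (‖a‖ₑ * c₀) ^ (3 : ℕ) * (4 * (Kn * Γ₃ + Kf * (ENNReal.ofReal ρ * Γ₁) ^ (3 : ℕ)))
            ≤ (‖a‖ₑ * c₀) ^ (3 : ℕ) * (4 * ((Kn + Kf) * (Γ₃ + (ENNReal.ofReal ρ * Γ₁) ^ (3 : ℕ)))) := by gcongr
          _ = _ := by ring

/-! ### The `L²` bound -/

/-- **The `L²` bound for the Newtonian gradient potential, with explicit dependence on the
source**: for `R > 0` there is `K_R < ∞` such that for every continuous `g` supported in
`B̄(0, 2R)` and every `a`, `∫ |T_a g|² ≤ |a|² K_R (∫|g|² + (∫|g|)²)` (near part `‖x‖ < 4R` by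
Young with the kernel `1_{|w|<6R}|w|⁻²`, far part `|T_a g(x)| ≤ |a| π⁻¹ ‖g‖₁ |x|⁻²` on `‖x‖ ≥ 4R`).
[cite: GilbargTrudinger2001, Lemma 4.1 with (4.9)] -/
theorem exists_lintegral_newtonGradPotential_sq_le {R : ℝ} (hR : 0 < R) :
    ∃ KR : ℝ≥0∞, KR < ⊤ ∧ ∀ (g : EuclideanSpace ℝ (Fin 3) → ℝ) (a : EuclideanSpace ℝ (Fin 3)),
      Continuous g → tsupport g ⊆ closedBall (0 : EuclideanSpace ℝ (Fin 3)) (2 * R) →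
      ∫⁻ x, ‖newtonGradPotential a g x‖ₑ ^ (2 : ℕ) ≤
        ‖a‖ₑ ^ (2 : ℕ) * KR * ((∫⁻ y, ‖g y‖ₑ ^ (2 : ℕ)) + (∫⁻ y, ‖g y‖ₑ) ^ (2 : ℕ)) := by
  set c₀ : ℝ≥0∞ := ENNReal.ofReal (4 * π)⁻¹ with hc₀
  set Wfar : ℝ≥0∞ := ∫⁻ x in {x : EuclideanSpace ℝ (Fin 3) | 4 * R ≤ ‖x‖}, ENNReal.ofReal ((‖x‖ ^ 2)⁻¹) ^ 2 with hWfar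
  have hWfart : Wfar < ⊤ := lintegral_far_weight_sq_lt_top hR
  set KR : ℝ≥0∞ := c₀ ^ (2 : ℕ) * (ENNReal.ofReal (4 * π * (6 * R)) ^ (2 : ℕ) + 16 * Wfar) with hKR
  refine ⟨KR, ?_, ?_⟩
  · refine ENNReal.mul_lt_top (ENNReal.pow_lt_top ENNReal.ofReal_lt_top) (ENNReal.add_lt_top.2 ⟨?_, ?_⟩)
    · exact ENNReal.pow_lt_top ENNReal.ofReal_lt_top
    · exact ENNReal.mul_lt_top ENNReal.ofNat_lt_top hWfart
  intro g a hg hsupp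
  have hGm : Measurable fun y => ‖g y‖ₑ := hg.measurable.enorm
  set k : EuclideanSpace ℝ (Fin 3) → ℝ≥0∞ := fun z => ENNReal.ofReal (nearProfile₂ (6 * R) ‖z‖) with hk
  have hkm : Measurable k := measurable_ofReal_profile_norm (measurable_nearProfile₂ _)
  set L : ℝ≥0∞ := ∫⁻ y, ‖g y‖ₑ with hL
  have hB : MeasurableSet {x : EuclideanSpace ℝ (Fin 3) | ‖x‖ < 4 * R} :=
    measurableSet_lt measurable_norm measurable_const
  have hB' : MeasurableSet {x : EuclideanSpace ℝ (Fin 3) | 4 * R ≤ ‖x‖} :=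
    measurableSet_le measurable_const measurable_norm
  have hcompl : {x : EuclideanSpace ℝ (Fin 3) | ‖x‖ < 4 * R}ᶜ = {x | 4 * R ≤ ‖x‖} := by
    ext x; simp [not_lt]
  have e2 : ∀ w : ℝ≥0∞, w ^ (2 : ℕ) = w ^ (2 : ℝ) := fun w => by rw [← ENNReal.rpow_natCast]; norm_num
  rw [← lintegral_add_compl _ hB, hcompl]
  -- ## near part
  have hnear : ∫⁻ x in {x : EuclideanSpace ℝ (Fin 3) | ‖x‖ < 4 * R}, ‖newtonGradPotential a g x‖ₑ ^ (2 : ℕ) ≤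
      ‖a‖ₑ ^ (2 : ℕ) * (c₀ ^ (2 : ℕ) * ENNReal.ofReal (4 * π * (6 * R)) ^ (2 : ℕ)) * ∫⁻ y, ‖g y‖ₑ ^ (2 : ℕ) := by
    have hpt : ∀ x ∈ {x : EuclideanSpace ℝ (Fin 3) | ‖x‖ < 4 * R},
        ‖newtonGradPotential a g x‖ₑ ^ (2 : ℕ) ≤ (‖a‖ₑ * c₀) ^ (2 : ℕ) * (∫⁻ y, ‖g y‖ₑ * k (x - y)) ^ (2 : ℝ) := by
      intro x hx
      have h := enorm_newtonGradPotential_le_lintegral a x (g := g)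
      rw [lintegral_kernel_eq_near hsupp hx] at h
      calc ‖newtonGradPotential a g x‖ₑ ^ (2 : ℕ) ≤ (‖a‖ₑ * c₀ * ∫⁻ y, ‖g y‖ₑ * k (x - y)) ^ (2 : ℕ) :=
            pow_le_pow_left' h 2
        _ = _ := by rw [mul_pow, e2 (∫⁻ y, ‖g y‖ₑ * k (x - y))]
    have hY := lintegral_rpow_lintegral_mul_kernel_le Real.HolderConjugate.two_two hGm hkm
      {x : EuclideanSpace ℝ (Fin 3) | ‖x‖ < 4 * R}
    have hk1 : ∫⁻ z, k z = ENNReal.ofReal (4 * π * (6 * R)) := lintegral_nearProfile₂_norm (by positivity)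
    calc ∫⁻ x in {x : EuclideanSpace ℝ (Fin 3) | ‖x‖ < 4 * R}, ‖newtonGradPotential a g x‖ₑ ^ (2 : ℕ)
        ≤ ∫⁻ x in {x : EuclideanSpace ℝ (Fin 3) | ‖x‖ < 4 * R},
            (‖a‖ₑ * c₀) ^ (2 : ℕ) * (∫⁻ y, ‖g y‖ₑ * k (x - y)) ^ (2 : ℝ) := setLIntegral_mono' hB hpt
      _ = (‖a‖ₑ * c₀) ^ (2 : ℕ) * ∫⁻ x in {x : EuclideanSpace ℝ (Fin 3) | ‖x‖ < 4 * R},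
            (∫⁻ y, ‖g y‖ₑ * k (x - y)) ^ (2 : ℝ) :=
          lintegral_const_mul' _ _ (ENNReal.pow_ne_top (ENNReal.mul_ne_top enorm_ne_top ENNReal.ofReal_ne_top))
      _ ≤ (‖a‖ₑ * c₀) ^ (2 : ℕ) * ((∫⁻ z, k z) ^ (2 : ℝ) * ∫⁻ y, ‖g y‖ₑ ^ (2 : ℝ)) := mul_le_mul' le_rfl hY
      _ = ‖a‖ₑ ^ (2 : ℕ) * (c₀ ^ (2 : ℕ) * ENNReal.ofReal (4 * π * (6 * R)) ^ (2 : ℕ)) * ∫⁻ y, ‖g y‖ₑ ^ (2 : ℕ) := by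
          rw [hk1, ← e2, mul_pow]
          simp_rw [← e2]
          ring
  -- ## far part
  have hfar : ∫⁻ x in {x : EuclideanSpace ℝ (Fin 3) | 4 * R ≤ ‖x‖}, ‖newtonGradPotential a g x‖ₑ ^ (2 : ℕ) ≤
      ‖a‖ₑ ^ (2 : ℕ) * (c₀ ^ (2 : ℕ) * (16 * Wfar)) * L ^ (2 : ℕ) := by
    have hpt : ∀ x ∈ {x : EuclideanSpace ℝ (Fin 3) | 4 * R ≤ ‖x‖},
        ‖newtonGradPotential a g x‖ₑ ^ (2 : ℕ) ≤
          (‖a‖ₑ * c₀ * (4 * L)) ^ (2 : ℕ) * ENNReal.ofReal ((‖x‖ ^ 2)⁻¹) ^ 2 := by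
      intro x hx
      have h := (enorm_newtonGradPotential_le_lintegral a x (g := g)).trans
        (mul_le_mul' le_rfl (lintegral_kernel_le_far hsupp hR hx))
      have e4 : ENNReal.ofReal (4 * (‖x‖ ^ 2)⁻¹) = 4 * ENNReal.ofReal ((‖x‖ ^ 2)⁻¹) := by
        rw [ENNReal.ofReal_mul (by norm_num), ENNReal.ofReal_ofNat]
      rw [e4] at h
      calc ‖newtonGradPotential a g x‖ₑ ^ (2 : ℕ)
          ≤ (‖a‖ₑ * c₀ * (4 * ENNReal.ofReal ((‖x‖ ^ 2)⁻¹) * L)) ^ (2 : ℕ) := pow_le_pow_left' h 2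
        _ = (‖a‖ₑ * c₀ * (4 * L)) ^ (2 : ℕ) * ENNReal.ofReal ((‖x‖ ^ 2)⁻¹) ^ 2 := by ring
    -- `L < ∞`
    have hgc : HasCompactSupport g := HasCompactSupport.of_support_subset_isCompact
      (isCompact_closedBall 0 (2 * R)) ((subset_tsupport g).trans hsupp)
    have hLt : L ≠ ⊤ := ((hg.integrable_of_hasCompactSupport hgc).2).ne
    calc ∫⁻ x in {x : EuclideanSpace ℝ (Fin 3) | 4 * R ≤ ‖x‖}, ‖newtonGradPotential a g x‖ₑ ^ (2 : ℕ)
        ≤ ∫⁻ x in {x : EuclideanSpace ℝ (Fin 3) | 4 * R ≤ ‖x‖},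
            (‖a‖ₑ * c₀ * (4 * L)) ^ (2 : ℕ) * ENNReal.ofReal ((‖x‖ ^ 2)⁻¹) ^ 2 := setLIntegral_mono' hB' hpt
      _ = (‖a‖ₑ * c₀ * (4 * L)) ^ (2 : ℕ) * Wfar := by
          rw [lintegral_const_mul' _ _ (ENNReal.pow_ne_top (ENNReal.mul_ne_top
            (ENNReal.mul_ne_top enorm_ne_top ENNReal.ofReal_ne_top) (ENNReal.mul_ne_top ENNReal.ofNat_ne_top hLt)))]
      _ = ‖a‖ₑ ^ (2 : ℕ) * (c₀ ^ (2 : ℕ) * (16 * Wfar)) * L ^ (2 : ℕ) := by ring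
  calc (∫⁻ x in {x : EuclideanSpace ℝ (Fin 3) | ‖x‖ < 4 * R}, ‖newtonGradPotential a g x‖ₑ ^ (2 : ℕ)) +
        ∫⁻ x in {x : EuclideanSpace ℝ (Fin 3) | 4 * R ≤ ‖x‖}, ‖newtonGradPotential a g x‖ₑ ^ (2 : ℕ)
      ≤ ‖a‖ₑ ^ (2 : ℕ) * (c₀ ^ (2 : ℕ) * ENNReal.ofReal (4 * π * (6 * R)) ^ (2 : ℕ)) * (∫⁻ y, ‖g y‖ₑ ^ (2 : ℕ)) +
          ‖a‖ₑ ^ (2 : ℕ) * (c₀ ^ (2 : ℕ) * (16 * Wfar)) * L ^ (2 : ℕ) := add_le_add hnear hfar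
    _ ≤ ‖a‖ₑ ^ (2 : ℕ) * KR * ((∫⁻ y, ‖g y‖ₑ ^ (2 : ℕ)) + L ^ (2 : ℕ)) := by
        rw [hKR]
        have h1 : c₀ ^ (2 : ℕ) * ENNReal.ofReal (4 * π * (6 * R)) ^ (2 : ℕ) ≤
            c₀ ^ (2 : ℕ) * (ENNReal.ofReal (4 * π * (6 * R)) ^ (2 : ℕ) + 16 * Wfar) := by gcongr; exact le_self_add
        have h2 : c₀ ^ (2 : ℕ) * (16 * Wfar) ≤
            c₀ ^ (2 : ℕ) * (ENNReal.ofReal (4 * π * (6 * R)) ^ (2 : ℕ) + 16 * Wfar) := by gcongr; exact le_add_self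
        calc _ ≤ ‖a‖ₑ ^ (2 : ℕ) * (c₀ ^ (2 : ℕ) * (ENNReal.ofReal (4 * π * (6 * R)) ^ (2 : ℕ) + 16 * Wfar)) *
              (∫⁻ y, ‖g y‖ₑ ^ (2 : ℕ)) +
            ‖a‖ₑ ^ (2 : ℕ) * (c₀ ^ (2 : ℕ) * (ENNReal.ofReal (4 * π * (6 * R)) ^ (2 : ℕ) + 16 * Wfar)) * L ^ (2 : ℕ) := by
              gcongr
          _ = _ := by ring

/-! ### Unit-ball covers with nearby centres -/

/-- **A ball of radius `2` is covered by finitely many unit balls with centres within distance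
`3`**, uniformly in the centre (filter the tree's finite cover). [folklore] -/
theorem exists_finset_norm_lt_ball_two_subset :
    ∃ F : Finset (EuclideanSpace ℝ (Fin 3)), (∀ c ∈ F, ‖c‖ < 3) ∧
      ∀ x₀ : EuclideanSpace ℝ (Fin 3), ball x₀ 2 ⊆ ⋃ c ∈ F, ball (x₀ + c) 1 := by
  classical
  obtain ⟨F, hF⟩ := exists_finset_ball_subset_biUnion_ball_one (2 : ℝ)
  refine ⟨F.filter fun c => ‖c‖ < 3, fun c hc => (Finset.mem_filter.1 hc).2, fun x₀ y hy => ?_⟩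
  obtain ⟨c, hc, hyc⟩ := mem_iUnion₂.1 (hF x₀ hy)
  have hc3 : ‖c‖ < 3 := by
    rw [mem_ball, dist_eq_norm] at hy hyc
    calc ‖c‖ = ‖(y - x₀) - (y - (x₀ + c))‖ := by congr 1; abel
      _ ≤ ‖y - x₀‖ + ‖y - (x₀ + c)‖ := norm_sub_le _ _
      _ < 2 + 1 := add_lt_add hy hyc
      _ = 3 := by norm_num
  exact mem_iUnion₂.2 ⟨c, Finset.mem_filter.2 ⟨hc, hc3⟩, hyc⟩

/-! ### Mollification of uniformly locally `L³` fields -/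

section Mollification

open scoped Convolution
open ContinuousLinearMap (lsmul)

variable {a : EuclideanSpace ℝ (Fin 3) → EuclideanSpace ℝ (Fin 3)}

/-- **Mollification is local**: for a bump `φ` of outer radius `≤ 1` and `x ∈ B(c, r)`,
`(φ̃ ⋆ a)(x) = (φ̃ ⋆ (1_{B(c,r+1)} a))(x)` (the kernel `φ̃(t)` vanishes unless `‖t‖ < 1`, and then
`x - t ∈ B(c, r+1)`). [folklore] -/
theorem normed_convolution_eq_indicator_of_mem_ball (φ : ContDiffBump (0 : EuclideanSpace ℝ (Fin 3)))
    (hφ : φ.rOut ≤ 1) {c x : EuclideanSpace ℝ (Fin 3)} {r : ℝ} (hx : x ∈ ball c r) :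
    (φ.normed volume ⋆[lsmul ℝ ℝ, volume] a) x =
      (φ.normed volume ⋆[lsmul ℝ ℝ, volume] (ball c (r + 1)).indicator a) x := by
  rw [convolution_lsmul, convolution_lsmul]
  refine integral_congr_ae (Eventually.of_forall fun t => ?_)
  by_cases ht : t ∈ Function.support (φ.normed volume)
  · rw [φ.support_normed_eq, mem_ball_zero_iff] at ht
    have hxt : x - t ∈ ball c (r + 1) := by
      rw [mem_ball, dist_eq_norm] at hx ⊢
      calc ‖x - t - c‖ = ‖(x - c) - t‖ := by abel_nf
        _ ≤ ‖x - c‖ + ‖t‖ := norm_sub_le _ _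
        _ < r + 1 := add_lt_add_of_lt_of_le hx (ht.le.trans hφ)
    simp only [indicator_of_mem hxt]
  · rw [Function.notMem_support] at ht
    simp only [ht, zero_smul]

/-- **Local `L³` contraction**: `∫_{B(c,r)} |φ̃ ⋆ a|³ ≤ ∫_{B(c,r+1)} |a|³` for a bump of outer radius
`≤ 1` (locality and Young's inequality `‖φ̃ ⋆ f‖₃ ≤ ‖f‖₃` with `f = 1_{B(c,r+1)} a`). [folklore] -/
theorem lintegral_ball_cube_normed_convolution_le (φ : ContDiffBump (0 : EuclideanSpace ℝ (Fin 3)))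
    (hφ : φ.rOut ≤ 1) (ham : AEStronglyMeasurable a volume) (c : EuclideanSpace ℝ (Fin 3)) (r : ℝ) :
    ∫⁻ x in ball c r, ‖(φ.normed volume ⋆[lsmul ℝ ℝ, volume] a) x‖ₑ ^ (3 : ℕ) ≤
      ∫⁻ x in ball c (r + 1), ‖a x‖ₑ ^ (3 : ℕ) := by
  set f : EuclideanSpace ℝ (Fin 3) → EuclideanSpace ℝ (Fin 3) := (ball c (r + 1)).indicator a with hf
  have hfm : AEStronglyMeasurable f volume := ham.indicator measurableSet_ball
  have e3 : ∀ w : ℝ≥0∞, w ^ (3 : ℕ) = w ^ (3 : ℝ) := fun w => by rw [← ENNReal.rpow_natCast]; norm_num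
  calc ∫⁻ x in ball c r, ‖(φ.normed volume ⋆[lsmul ℝ ℝ, volume] a) x‖ₑ ^ (3 : ℕ)
      = ∫⁻ x in ball c r, ‖(φ.normed volume ⋆[lsmul ℝ ℝ, volume] f) x‖ₑ ^ (3 : ℕ) := by
        refine setLIntegral_congr_fun measurableSet_ball fun x hx => ?_
        rw [normed_convolution_eq_indicator_of_mem_ball φ hφ hx]
    _ ≤ ∫⁻ x, ‖(φ.normed volume ⋆[lsmul ℝ ℝ, volume] f) x‖ₑ ^ (3 : ℕ) := setLIntegral_le_lintegral _ _
    _ = eLpNorm (φ.normed volume ⋆[lsmul ℝ ℝ, volume] f) 3 volume ^ (3 : ℝ) := by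
        simp_rw [e3]; exact lintegral_enorm_rpow_three_eq_eLpNorm_rpow _ _
    _ ≤ eLpNorm f 3 volume ^ (3 : ℝ) :=
        ENNReal.rpow_le_rpow (FunctionSpaces.eLpNorm_normed_convolution_le φ hfm (by norm_num)) (by norm_num)
    _ = ∫⁻ x, ‖f x‖ₑ ^ (3 : ℕ) := by
        simp_rw [e3]; exact (lintegral_enorm_rpow_three_eq_eLpNorm_rpow _ _).symm
    _ = ∫⁻ x in ball c (r + 1), ‖a x‖ₑ ^ (3 : ℕ) := by
        rw [← lintegral_indicator measurableSet_ball]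
        refine lintegral_congr fun x => ?_
        simp only [hf]
        by_cases hx : x ∈ ball c (r + 1)
        · rw [indicator_of_mem hx, indicator_of_mem hx]
        · rw [indicator_of_notMem hx, indicator_of_notMem hx, enorm_zero, zero_pow three_ne_zero]

/-- **Cube integrals over balls of radius `2` from unit-ball bounds at nearby centres**: with the
cover of `exists_finset_norm_lt_ball_two_subset`, `∫_{B(c,2)} |a|³ ≤ |F| sup_{c' ∈ F} ∫_{B(c+c',1)} |a|³`.
[folklore] -/
theorem lintegral_ball_two_le_card_mul {F : Finset (EuclideanSpace ℝ (Fin 3))}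
    (hF : ∀ x₀ : EuclideanSpace ℝ (Fin 3), ball x₀ 2 ⊆ ⋃ c ∈ F, ball (x₀ + c) 1)
    (f : EuclideanSpace ℝ (Fin 3) → ℝ≥0∞) (c : EuclideanSpace ℝ (Fin 3)) {B : ℝ≥0∞}
    (hB : ∀ c' ∈ F, ∫⁻ x in ball (c + c') 1, f x ≤ B) :
    ∫⁻ x in ball c 2, f x ≤ F.card * B :=
  (lintegral_mono_set (hF c)).trans (lintegral_biUnion_finset_le_card_mul F _ _ hB)

/-- **Uniformly locally `L³` fields are locally integrable.** [folklore] -/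
theorem locallyIntegrable_of_forall_lintegral_ball_cube_le (ham : AEStronglyMeasurable a volume) {A : ℝ≥0∞}
    (hAt : A ≠ ⊤) (hA : ∀ c : EuclideanSpace ℝ (Fin 3), ∫⁻ x in ball c 1, ‖a x‖ₑ ^ (3 : ℕ) ≤ A) :
    LocallyIntegrable a volume := by
  intro x
  refine ⟨ball x 1, ball_mem_nhds x one_pos, ?_⟩
  have h3 : MemLp a 3 (volume.restrict (ball x 1)) := by
    refine ⟨ham.restrict, ?_⟩
    have e3 : ∀ w : ℝ≥0∞, w ^ (3 : ℕ) = w ^ (3 : ℝ) := fun w => by rw [← ENNReal.rpow_natCast]; norm_num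
    have h := hA x
    simp_rw [e3] at h
    rw [lintegral_enorm_rpow_three_eq_eLpNorm_rpow] at h
    have h' : eLpNorm a 3 (volume.restrict (ball x 1)) ^ (3 : ℝ) < ⊤ := h.trans_lt hAt.lt_top
    exact (ENNReal.rpow_lt_top_iff_of_pos (by norm_num)).1 h'
  haveI : IsFiniteMeasure (volume.restrict (ball x 1)) := ⟨by
    rw [Measure.restrict_apply_univ]; exact measure_ball_lt_top⟩
  exact (h3.mono_exponent (by norm_num : (1 : ℝ≥0∞) ≤ 3)).integrable le_rfl

/-- **`L^p` on balls from uniformly local `L³` bounds** (`p ≤ 3`): `1_{B(0,ρ)} a ∈ L^p(ℝ³)`. [folklore] -/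
theorem memLp_indicator_ball_of_forall_lintegral_ball_cube_le (ham : AEStronglyMeasurable a volume) {A : ℝ≥0∞}
    (hAt : A ≠ ⊤) (hA : ∀ c : EuclideanSpace ℝ (Fin 3), ∫⁻ x in ball c 1, ‖a x‖ₑ ^ (3 : ℕ) ≤ A)
    (ρ : ℝ) {p : ℝ≥0∞} (hp : p ≤ 3) :
    MemLp ((ball (0 : EuclideanSpace ℝ (Fin 3)) ρ).indicator a) p volume := by
  obtain ⟨F, hF⟩ := exists_finset_ball_subset_biUnion_ball_one ρ
  -- `a ∈ L³(B(0, ρ))`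
  have h3 : MemLp a 3 (volume.restrict (ball (0 : EuclideanSpace ℝ (Fin 3)) ρ)) := by
    refine ⟨ham.restrict, ?_⟩
    have e3 : ∀ w : ℝ≥0∞, w ^ (3 : ℕ) = w ^ (3 : ℝ) := fun w => by rw [← ENNReal.rpow_natCast]; norm_num
    have hle : ∫⁻ x in ball (0 : EuclideanSpace ℝ (Fin 3)) ρ, ‖a x‖ₑ ^ (3 : ℕ) ≤ F.card * A := by
      have h := lintegral_biUnion_finset_le_card_mul F (fun c => ball ((0 : EuclideanSpace ℝ (Fin 3)) + c) 1)
        (fun x => ‖a x‖ₑ ^ (3 : ℕ)) (μ := volume) (C := A) fun c _ => hA (0 + c)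
      exact (lintegral_mono_set (hF 0)).trans h
    simp_rw [e3] at hle
    rw [lintegral_enorm_rpow_three_eq_eLpNorm_rpow] at hle
    have h' : eLpNorm a 3 (volume.restrict (ball (0 : EuclideanSpace ℝ (Fin 3)) ρ)) ^ (3 : ℝ) < ⊤ :=
      hle.trans_lt (ENNReal.mul_lt_top (ENNReal.natCast_lt_top _) hAt.lt_top)
    exact (ENNReal.rpow_lt_top_iff_of_pos (by norm_num)).1 h'
  haveI : IsFiniteMeasure (volume.restrict (ball (0 : EuclideanSpace ℝ (Fin 3)) ρ)) := ⟨by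
    rw [Measure.restrict_apply_univ]; exact measure_ball_lt_top⟩
  have hp' : MemLp a p (volume.restrict (ball (0 : EuclideanSpace ℝ (Fin 3)) ρ)) := h3.mono_exponent hp
  exact (memLp_indicator_iff_restrict measurableSet_ball).2 hp'

/-- **Mollifications converge in `L²` on balls** for uniformly locally `L³` fields: if the outer radii
of the bumps `φ_k` (all `≤ 1`) tend to `0`, then `∫_{B(0,ρ)} |φ̃_k ⋆ a − a|² → 0` (locality on
`B(0,ρ)` and `L²`-convergence of the mollifications of `1_{B(0,ρ+1)} a ∈ L²`). [folklore] -/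
theorem tendsto_lintegral_ball_normed_convolution_sub_sq {φ : ℕ → ContDiffBump (0 : EuclideanSpace ℝ (Fin 3))}
    (hφ : Tendsto (fun k => (φ k).rOut) atTop (𝓝 0)) (hφ1 : ∀ k, (φ k).rOut ≤ 1)
    (ham : AEStronglyMeasurable a volume) {A : ℝ≥0∞} (hAt : A ≠ ⊤)
    (hA : ∀ c : EuclideanSpace ℝ (Fin 3), ∫⁻ x in ball c 1, ‖a x‖ₑ ^ (3 : ℕ) ≤ A) (ρ : ℝ) :
    Tendsto (fun k => ∫⁻ x in ball (0 : EuclideanSpace ℝ (Fin 3)) ρ,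
      ‖((φ k).normed volume ⋆[lsmul ℝ ℝ, volume] a) x - a x‖ₑ ^ 2) atTop (𝓝 0) := by
  set f : EuclideanSpace ℝ (Fin 3) → EuclideanSpace ℝ (Fin 3) := (ball (0 : EuclideanSpace ℝ (Fin 3)) (ρ + 1)).indicator a
    with hf
  have hf2 : MemLp f 2 volume :=
    memLp_indicator_ball_of_forall_lintegral_ball_cube_le ham hAt hA (ρ + 1) (by norm_num)
  have hconv := FunctionSpaces.tendsto_eLpNorm_normed_convolution_sub_self (μ := volume) hφ (p := 2)
    (by norm_num) ENNReal.ofNat_ne_top hf2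
  -- `∫_{B(0,ρ)} |φ̃_k ⋆ a − a|² ≤ ‖φ̃_k ⋆ f − f‖₂²`
  have hle : ∀ k, ∫⁻ x in ball (0 : EuclideanSpace ℝ (Fin 3)) ρ,
      ‖((φ k).normed volume ⋆[lsmul ℝ ℝ, volume] a) x - a x‖ₑ ^ 2 ≤
        eLpNorm ((φ k).normed volume ⋆[lsmul ℝ ℝ, volume] f - f) 2 volume ^ 2 := by
    intro k
    calc ∫⁻ x in ball (0 : EuclideanSpace ℝ (Fin 3)) ρ, ‖((φ k).normed volume ⋆[lsmul ℝ ℝ, volume] a) x - a x‖ₑ ^ 2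
        = ∫⁻ x in ball (0 : EuclideanSpace ℝ (Fin 3)) ρ,
            ‖((φ k).normed volume ⋆[lsmul ℝ ℝ, volume] f) x - f x‖ₑ ^ 2 := by
          refine setLIntegral_congr_fun measurableSet_ball fun x hx => ?_
          have hx' : x ∈ ball (0 : EuclideanSpace ℝ (Fin 3)) (ρ + 1) := ball_subset_ball (by linarith) hx
          rw [normed_convolution_eq_indicator_of_mem_ball (φ k) (hφ1 k) hx]
          simp only [hf, indicator_of_mem hx']
      _ ≤ ∫⁻ x, ‖((φ k).normed volume ⋆[lsmul ℝ ℝ, volume] f) x - f x‖ₑ ^ 2 := setLIntegral_le_lintegral _ _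
      _ = eLpNorm ((φ k).normed volume ⋆[lsmul ℝ ℝ, volume] f - f) 2 volume ^ 2 := by
          rw [lintegral_enorm_sq_eq_eLpNorm_two_sq]; rfl
  have hsq : Tendsto (fun k => eLpNorm ((φ k).normed volume ⋆[lsmul ℝ ℝ, volume] f - f) 2 volume ^ 2) atTop (𝓝 0) := by
    have h := (ENNReal.Tendsto.pow (n := 2) hconv)
    simpa using h
  exact tendsto_of_tendsto_of_tendsto_of_le_of_le tendsto_const_nhds hsq (fun _ => zero_le) hle

end Mollification

/-! ### Hölder on unit balls -/

/-- `∫_{B(c,1)} h ≤ |B₁|^{2/3} (∫_{B(c,1)} h³)^{1/3}` (Hölder with the constant `1`). [folklore] -/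
theorem lintegral_unitBall_le_rpow_cube {h : EuclideanSpace ℝ (Fin 3) → ℝ≥0∞} (hm : AEMeasurable h volume)
    (c : EuclideanSpace ℝ (Fin 3)) :
    ∫⁻ x in ball c 1, h x ≤ volume (ball (0 : EuclideanSpace ℝ (Fin 3)) 1) ^ (2 / 3 : ℝ) *
      (∫⁻ x in ball c 1, h x ^ (3 : ℕ)) ^ (1 / 3 : ℝ) := by
  set μ : Measure (EuclideanSpace ℝ (Fin 3)) := volume.restrict (ball c 1) with hμ
  have h3 : (3 : ℝ).HolderConjugate (3 / 2) := by rw [Real.holderConjugate_iff]; norm_num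
  have hH := ENNReal.lintegral_mul_le_Lp_mul_Lq μ h3 hm.restrict (g := fun _ => (1 : ℝ≥0∞)) aemeasurable_const
  simp only [Pi.mul_apply, mul_one, ENNReal.one_rpow, lintegral_const, one_mul] at hH
  rw [hμ, Measure.restrict_apply_univ, Measure.addHaar_ball_center volume c 1, ← hμ] at hH
  have e3 : ∀ w : ℝ≥0∞, w ^ (3 : ℝ) = w ^ (3 : ℕ) := fun w => by rw [← ENNReal.rpow_natCast]; norm_num
  simp_rw [e3] at hH
  calc ∫⁻ x in ball c 1, h x ≤ (∫⁻ x, h x ^ (3 : ℕ) ∂μ) ^ (1 / (3 : ℝ)) *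
        volume (ball (0 : EuclideanSpace ℝ (Fin 3)) 1) ^ (1 / (3 / 2 : ℝ)) := hH
    _ = _ := by rw [mul_comm]; norm_num

/-- `∫_{B(c,1)} h² ≤ |B₁|^{1/3} (∫_{B(c,1)} h³)^{2/3}` (Hölder with the constant `1`). [folklore] -/
theorem lintegral_unitBall_sq_le_rpow_cube {h : EuclideanSpace ℝ (Fin 3) → ℝ≥0∞} (hm : AEMeasurable h volume)
    (c : EuclideanSpace ℝ (Fin 3)) :
    ∫⁻ x in ball c 1, h x ^ (2 : ℕ) ≤ volume (ball (0 : EuclideanSpace ℝ (Fin 3)) 1) ^ (1 / 3 : ℝ) *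
      (∫⁻ x in ball c 1, h x ^ (3 : ℕ)) ^ (2 / 3 : ℝ) := by
  set μ : Measure (EuclideanSpace ℝ (Fin 3)) := volume.restrict (ball c 1) with hμ
  have h32 : (3 / 2 : ℝ).HolderConjugate 3 := by rw [Real.holderConjugate_iff]; norm_num
  have hH := ENNReal.lintegral_mul_le_Lp_mul_Lq μ h32 ((hm.pow_const 2).restrict) (g := fun _ => (1 : ℝ≥0∞))
    aemeasurable_const
  simp only [Pi.mul_apply, mul_one, ENNReal.one_rpow, lintegral_const, one_mul] at hH
  rw [hμ, Measure.restrict_apply_univ, Measure.addHaar_ball_center volume c 1, ← hμ] at hH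
  have e3 : ∀ x, (h x ^ (2 : ℕ)) ^ (3 / 2 : ℝ) = h x ^ (3 : ℕ) := fun x => by
    rw [← ENNReal.rpow_natCast, ← ENNReal.rpow_natCast, ← ENNReal.rpow_mul]; norm_num
  simp_rw [e3] at hH
  calc ∫⁻ x in ball c 1, h x ^ (2 : ℕ) ≤ (∫⁻ x, h x ^ (3 : ℕ) ∂μ) ^ (1 / (3 / 2 : ℝ)) *
        volume (ball (0 : EuclideanSpace ℝ (Fin 3)) 1) ^ (1 / (3 : ℝ)) := hH
    _ = _ := by rw [mul_comm]; norm_num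

/-- `(x + y + z)³ ≤ 16 (x³ + y³ + z³)` in `ℝ≥0∞`. [folklore] -/
theorem ennreal_add_three_pow_three_le (x y z : ℝ≥0∞) :
    (x + y + z) ^ (3 : ℕ) ≤ 16 * (x ^ (3 : ℕ) + y ^ (3 : ℕ) + z ^ (3 : ℕ)) := by
  have hcube : ∀ p q : ℝ≥0∞, (p + q) ^ (3 : ℕ) ≤ 4 * (p ^ (3 : ℕ) + q ^ (3 : ℕ)) := fun p q => by
    have h := ENNReal.rpow_add_le_mul_rpow_add_rpow p q (by norm_num : (1 : ℝ) ≤ 3)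
    have e4 : (2 : ℝ≥0∞) ^ ((3 : ℝ) - 1) = 4 := by
      rw [show (3 : ℝ) - 1 = ((2 : ℕ) : ℝ) by norm_num, ENNReal.rpow_natCast]; norm_num
    have e3 : ∀ w : ℝ≥0∞, w ^ (3 : ℝ) = w ^ (3 : ℕ) := fun w => by
      rw [show (3 : ℝ) = ((3 : ℕ) : ℝ) by norm_num, ENNReal.rpow_natCast]
    simpa only [e4, e3] using h
  calc (x + y + z) ^ (3 : ℕ) = (x + (y + z)) ^ (3 : ℕ) := by rw [add_assoc]
    _ ≤ 4 * (x ^ (3 : ℕ) + (y + z) ^ (3 : ℕ)) := hcube _ _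
    _ ≤ 4 * (x ^ (3 : ℕ) + 4 * (y ^ (3 : ℕ) + z ^ (3 : ℕ))) := by gcongr; exact hcube _ _
    _ ≤ 16 * (x ^ (3 : ℕ) + y ^ (3 : ℕ) + z ^ (3 : ℕ)) := by
        rw [show (16 : ℝ≥0∞) = 4 * 4 by norm_num]
        calc 4 * (x ^ (3 : ℕ) + 4 * (y ^ (3 : ℕ) + z ^ (3 : ℕ)))
            ≤ 4 * (4 * x ^ (3 : ℕ) + 4 * (y ^ (3 : ℕ) + z ^ (3 : ℕ))) := by
              gcongr
              exact le_mul_of_one_le_left' (by norm_num)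
          _ = 4 * 4 * (x ^ (3 : ℕ) + y ^ (3 : ℕ) + z ^ (3 : ℕ)) := by ring

/-! ### The source `g = Dχ_R(v)` of the truncation: pointwise and uniformly local bounds -/

section Source

variable {v : EuclideanSpace ℝ (Fin 3) → EuclideanSpace ℝ (Fin 3)} {R : ℝ}

/-- **Pointwise bound of the source**: with `‖Dχ_R‖ ≤ C_g/R`,
`‖Dχ_R(x)(v x)‖ₑ ≤ ofReal(C_g/R) · 1_{R ≤ ‖x‖} ‖v x‖ₑ`. [folklore] -/
theorem enorm_truncSource_le {Cg : ℝ} (hCg : ∀ R : ℝ, 0 < R → ∀ x : EuclideanSpace ℝ (Fin 3),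
      ‖fderiv ℝ (cutoff (E := EuclideanSpace ℝ (Fin 3)) R) x‖ ≤ Cg / R) (hR : 0 < R) (x : EuclideanSpace ℝ (Fin 3)) :
    ‖fderiv ℝ (cutoff (E := EuclideanSpace ℝ (Fin 3)) R) x (v x)‖ₑ ≤
      ENNReal.ofReal (Cg / R) * {y : EuclideanSpace ℝ (Fin 3) | R ≤ ‖y‖}.indicator (fun y => ‖v y‖ₑ) x := by
  by_cases hx : R ≤ ‖x‖
  · rw [indicator_of_mem (show x ∈ {y : EuclideanSpace ℝ (Fin 3) | R ≤ ‖y‖} from hx), ← ofReal_norm,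
      ← ofReal_norm (v x), ← ENNReal.ofReal_mul ((norm_nonneg _).trans (hCg R hR x))]
    exact ENNReal.ofReal_le_ofReal ((ContinuousLinearMap.le_opNorm _ _).trans
      (mul_le_mul_of_nonneg_right (hCg R hR x) (norm_nonneg _)))
  · rw [truncSource_eq_zero hR (Or.inl (not_le.1 hx)), enorm_zero]
    exact zero_le

/-- The source vanishes unless `‖y‖ ≤ 2R`. [folklore] -/
theorem norm_le_of_truncSource_ne_zero (hR : 0 < R) {y : EuclideanSpace ℝ (Fin 3)}
    (hy : fderiv ℝ (cutoff (E := EuclideanSpace ℝ (Fin 3)) R) y (v y) ≠ 0) : ‖y‖ ≤ 2 * R := by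
  by_contra h
  exact hy (truncSource_eq_zero hR (Or.inr (not_le.1 h)))

/-- **Uniformly local cube bound of the source**: if `∫_{B(c,1)} |v|³ ≤ τ` for all centres with
`‖c‖ ≥ R - 1`, then `∫_{B(c,1)} |g|³ ≤ (C_g/R)³ τ` for **every** centre (balls with `‖c‖ < R - 1`
do not meet the support). [folklore] -/
theorem lintegral_unitBall_truncSource_cube_le {Cg : ℝ} (hCg0 : 0 ≤ Cg)
    (hCg : ∀ R : ℝ, 0 < R → ∀ x : EuclideanSpace ℝ (Fin 3),
      ‖fderiv ℝ (cutoff (E := EuclideanSpace ℝ (Fin 3)) R) x‖ ≤ Cg / R) (hR : 0 < R) {τ : ℝ≥0∞}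
    (hτ : ∀ c : EuclideanSpace ℝ (Fin 3), R - 1 ≤ ‖c‖ → ∫⁻ x in ball c 1, ‖v x‖ₑ ^ (3 : ℕ) ≤ τ)
    (c : EuclideanSpace ℝ (Fin 3)) :
    ∫⁻ x in ball c 1, ‖fderiv ℝ (cutoff (E := EuclideanSpace ℝ (Fin 3)) R) x (v x)‖ₑ ^ (3 : ℕ) ≤
      ENNReal.ofReal ((Cg / R) ^ 3) * τ := by
  by_cases hc : R - 1 ≤ ‖c‖
  · calc ∫⁻ x in ball c 1, ‖fderiv ℝ (cutoff (E := EuclideanSpace ℝ (Fin 3)) R) x (v x)‖ₑ ^ (3 : ℕ)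
        ≤ ∫⁻ x in ball c 1, (ENNReal.ofReal (Cg / R) * ‖v x‖ₑ) ^ (3 : ℕ) := by
          refine lintegral_mono fun x => pow_le_pow_left' ((enorm_truncSource_le hCg hR x).trans ?_) 3
          refine mul_le_mul' le_rfl ?_
          by_cases hx : x ∈ {y : EuclideanSpace ℝ (Fin 3) | R ≤ ‖y‖}
          · rw [indicator_of_mem hx]
          · rw [indicator_of_notMem hx]; exact zero_le
      _ = ENNReal.ofReal ((Cg / R) ^ 3) * ∫⁻ x in ball c 1, ‖v x‖ₑ ^ (3 : ℕ) := by
          simp_rw [mul_pow]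
          rw [lintegral_const_mul' _ _ (ENNReal.pow_ne_top ENNReal.ofReal_ne_top), ENNReal.ofReal_pow (by positivity)]
      _ ≤ ENNReal.ofReal ((Cg / R) ^ 3) * τ := mul_le_mul' le_rfl (hτ c hc)
  · -- the ball does not meet `{R ≤ ‖x‖}`
    have h0 : ∀ x ∈ ball c 1, fderiv ℝ (cutoff (E := EuclideanSpace ℝ (Fin 3)) R) x (v x) = 0 := by
      intro x hx
      refine truncSource_eq_zero hR (Or.inl ?_)
      rw [mem_ball, dist_eq_norm] at hx
      calc ‖x‖ = ‖(x - c) + c‖ := by rw [sub_add_cancel]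
        _ ≤ ‖x - c‖ + ‖c‖ := norm_add_le _ _
        _ < 1 + (R - 1) := add_lt_add hx (not_le.1 hc)
        _ = R := by ring
    rw [setLIntegral_congr_fun measurableSet_ball (fun x hx => by rw [h0 x hx])]
    simp

end Source

/-! ### The corrector: uniformly local cube bound, `L²` bound, boundedness -/

section Corrector

variable {v : EuclideanSpace ℝ (Fin 3) → EuclideanSpace ℝ (Fin 3)} {R : ℝ}

/-- Pointwise: `‖Σⱼ Tⱼ(x) eⱼ‖ₑ ≤ Σⱼ ‖Tⱼ(x)‖ₑ` for the three coordinate directions. [folklore] -/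
theorem enorm_sum_smul_single_le (T : Fin 3 → ℝ) :
    ‖∑ j : Fin 3, T j • EuclideanSpace.single j (1 : ℝ)‖ₑ ≤ ‖T 0‖ₑ + ‖T 1‖ₑ + ‖T 2‖ₑ := by
  have h : ‖∑ j : Fin 3, T j • EuclideanSpace.single j (1 : ℝ)‖ ≤ ‖T 0‖ + ‖T 1‖ + ‖T 2‖ := by
    refine (norm_sum_le _ _).trans (le_of_eq ?_)
    simp only [norm_smul, PiLp.norm_single, norm_one, mul_one, Fin.sum_univ_three]
  rw [← ofReal_norm, ← ofReal_norm (T 0), ← ofReal_norm (T 1), ← ofReal_norm (T 2),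
    ← ENNReal.ofReal_add (norm_nonneg _) (norm_nonneg _),
    ← ENNReal.ofReal_add (add_nonneg (norm_nonneg _) (norm_nonneg _)) (norm_nonneg _)]
  exact ENNReal.ofReal_le_ofReal h

/-- **The uniformly local `L³` bound of the Newtonian corrector of the truncation.** There is a
universal `K₁ < ∞` such that: for a `C¹` field `v`, a radius `R ≥ 1`, and `τ` with
`∫_{B(c,1)} |v|³ ≤ τ` whenever `‖c‖ ≥ R − 1`, the corrector `F = Σⱼ T_{eⱼ}[Dχ_R(v)] eⱼ` satisfies
`∫_{B(z,1)} |F|³ ≤ K₁ τ` for **every** centre `z` — the corrector is uniformly small in `L³_uloc` when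
`v` is small on the annulus `R ≤ ‖x‖ ≤ 2R`, independently of `R` (this is where the decay at
infinity of the datum enters the extension step; Lemarié-Rieusset 2016, proof of Thm. 14.8, Step 2).
[cite: LemarieRieusset2016, Thm. 14.8 proof Step 2 (PDF pp. 521–524)] -/
theorem exists_lintegral_unitBall_newtonCorrector_cube_le :
    ∃ K₁ : ℝ≥0∞, K₁ < ⊤ ∧ ∀ (v : EuclideanSpace ℝ (Fin 3) → EuclideanSpace ℝ (Fin 3)) (R : ℝ) (τ : ℝ≥0∞),
      ContDiff ℝ 1 v → 1 ≤ R →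
      (∀ c : EuclideanSpace ℝ (Fin 3), R - 1 ≤ ‖c‖ → ∫⁻ x in ball c 1, ‖v x‖ₑ ^ (3 : ℕ) ≤ τ) →
      ∀ z : EuclideanSpace ℝ (Fin 3),
        ∫⁻ x in ball z 1, ‖∑ j : Fin 3, newtonGradPotential (EuclideanSpace.single j (1 : ℝ)) (fun y => fderiv ℝ (cutoff (E := EuclideanSpace ℝ (Fin 3)) R) y (v y)) x • EuclideanSpace.single j (1 : ℝ)‖ₑ ^ (3 : ℕ) ≤ K₁ * τ := by
  obtain ⟨K, hKt, hK⟩ := exists_lintegral_unitBall_newtonGradPotential_cube_le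
  obtain ⟨Cg, hCg0, hCg⟩ := exists_norm_fderiv_cutoff_le (E := EuclideanSpace ℝ (Fin 3))
  set V : ℝ≥0∞ := volume (ball (0 : EuclideanSpace ℝ (Fin 3)) 1) with hV
  have hVt : V ≠ ⊤ := measure_ball_lt_top.ne
  -- `K₁ = 16 · 3 · K · ofReal(Cg³) (1 + 8 V²)`
  set K₁ : ℝ≥0∞ := 16 * (3 * (K * (ENNReal.ofReal (Cg ^ 3) * (1 + 8 * V ^ (2 : ℕ))))) with hK₁
  refine ⟨K₁, ?_, ?_⟩
  · refine ENNReal.mul_lt_top ENNReal.ofNat_lt_top (ENNReal.mul_lt_top ENNReal.ofNat_lt_top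
      (ENNReal.mul_lt_top hKt (ENNReal.mul_lt_top ENNReal.ofReal_lt_top ?_)))
    exact ENNReal.add_lt_top.2 ⟨ENNReal.one_lt_top, ENNReal.mul_lt_top ENNReal.ofNat_lt_top (ENNReal.pow_lt_top hVt.lt_top)⟩
  intro v R τ hv hR hτ z
  have hR0 : 0 < R := one_pos.trans_le hR
  set g : EuclideanSpace ℝ (Fin 3) → ℝ := fun y => fderiv ℝ (cutoff (E := EuclideanSpace ℝ (Fin 3)) R) y (v y) with hg
  have hgc : Continuous g := (contDiff_truncSource hv R).continuous
  have hsupp : ∀ y, g y ≠ 0 → ‖y‖ ≤ 2 * R := fun y hy => norm_le_of_truncSource_ne_zero hR0 hy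
  -- the uniformly local sizes of `g`
  set Γ₃ : ℝ≥0∞ := ENNReal.ofReal ((Cg / R) ^ 3) * τ with hΓ₃
  have hΓ₃b : ∀ c : EuclideanSpace ℝ (Fin 3), ∫⁻ y in ball c 1, ‖g y‖ₑ ^ (3 : ℕ) ≤ Γ₃ := fun c =>
    lintegral_unitBall_truncSource_cube_le hCg0 hCg hR0 hτ c
  set Γ₁ : ℝ≥0∞ := V ^ (2 / 3 : ℝ) * Γ₃ ^ (1 / 3 : ℝ) with hΓ₁
  have hΓ₁b : ∀ c : EuclideanSpace ℝ (Fin 3), ∫⁻ y in ball c 1, ‖g y‖ₑ ≤ Γ₁ := fun c =>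
    (lintegral_unitBall_le_rpow_cube hgc.measurable.enorm.aemeasurable c).trans
      (mul_le_mul' le_rfl (ENNReal.rpow_le_rpow (hΓ₃b c) (by norm_num)))
  -- the bound for each direction
  have hdir : ∀ j : Fin 3, ∫⁻ x in ball z 1, ‖newtonGradPotential (EuclideanSpace.single j (1 : ℝ)) g x‖ₑ ^ (3 : ℕ) ≤
      K * (ENNReal.ofReal (Cg ^ 3) * (1 + 8 * V ^ (2 : ℕ))) * τ := by
    intro j
    have h := hK g (EuclideanSpace.single j (1 : ℝ)) (2 * R) Γ₁ Γ₃ hgc (by linarith) hsupp hΓ₃b hΓ₁b z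
    have e1 : ‖EuclideanSpace.single j (1 : ℝ)‖ₑ = 1 := by
      rw [← ofReal_norm, PiLp.norm_single, norm_one, ENNReal.ofReal_one]
    rw [e1, one_pow, mul_one] at h
    refine h.trans ?_
    -- `Γ₃ + (2R Γ₁)³ = ofReal(Cg³) (R⁻³ + 8 V²) τ ≤ ofReal(Cg³)(1 + 8V²) τ`
    have hV23 : (V ^ (2 / 3 : ℝ)) ^ (3 : ℕ) = V ^ (2 : ℕ) := by
      rw [← ENNReal.rpow_natCast, ← ENNReal.rpow_mul, show (2 / 3 : ℝ) * ((3 : ℕ) : ℝ) = ((2 : ℕ) : ℝ) by norm_num,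
        ENNReal.rpow_natCast]
    have hΓ13 : (Γ₃ ^ (1 / 3 : ℝ)) ^ (3 : ℕ) = Γ₃ := by
      rw [← ENNReal.rpow_natCast, ← ENNReal.rpow_mul, show (1 / 3 : ℝ) * ((3 : ℕ) : ℝ) = 1 by norm_num, ENNReal.rpow_one]
    have eΓ : (ENNReal.ofReal (2 * R) * Γ₁) ^ (3 : ℕ) = ENNReal.ofReal ((2 * R) ^ 3) * V ^ (2 : ℕ) * Γ₃ := by
      rw [hΓ₁, mul_pow, mul_pow, hV23, hΓ13, ENNReal.ofReal_pow (by positivity)]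
      ring
    have e8 : ENNReal.ofReal ((2 * R) ^ 3) * ENNReal.ofReal ((Cg / R) ^ 3) = 8 * ENNReal.ofReal (Cg ^ 3) := by
      rw [← ENNReal.ofReal_mul (by positivity), ← ENNReal.ofReal_ofNat 8, ← ENNReal.ofReal_mul (by norm_num)]
      congr 1
      field_simp
      ring
    have hR3 : ENNReal.ofReal ((Cg / R) ^ 3) ≤ ENNReal.ofReal (Cg ^ 3) := by
      refine ENNReal.ofReal_le_ofReal ?_
      rw [div_pow]
      exact div_le_self (by positivity) (one_le_pow₀ hR)
    calc K * (Γ₃ + (ENNReal.ofReal (2 * R) * Γ₁) ^ (3 : ℕ))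
        = K * (ENNReal.ofReal ((Cg / R) ^ 3) * τ + 8 * ENNReal.ofReal (Cg ^ 3) * V ^ (2 : ℕ) * τ) := by
          rw [eΓ, hΓ₃]
          congr 1
          rw [show ENNReal.ofReal ((2 * R) ^ 3) * V ^ (2 : ℕ) * (ENNReal.ofReal ((Cg / R) ^ 3) * τ) =
            (ENNReal.ofReal ((2 * R) ^ 3) * ENNReal.ofReal ((Cg / R) ^ 3)) * V ^ (2 : ℕ) * τ by ring, e8]
      _ ≤ K * (ENNReal.ofReal (Cg ^ 3) * τ + 8 * ENNReal.ofReal (Cg ^ 3) * V ^ (2 : ℕ) * τ) := by gcongr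
      _ = K * (ENNReal.ofReal (Cg ^ 3) * (1 + 8 * V ^ (2 : ℕ))) * τ := by ring
  -- summing the three directions
  set T : Fin 3 → EuclideanSpace ℝ (Fin 3) → ℝ := fun j x => newtonGradPotential (EuclideanSpace.single j (1 : ℝ)) g x with hT
  calc ∫⁻ x in ball z 1, ‖∑ j : Fin 3, newtonGradPotential (EuclideanSpace.single j (1 : ℝ)) (fun y => fderiv ℝ (cutoff (E := EuclideanSpace ℝ (Fin 3)) R) y (v y)) x • EuclideanSpace.single j (1 : ℝ)‖ₑ ^ (3 : ℕ)
      ≤ ∫⁻ x in ball z 1, 16 * (‖T 0 x‖ₑ ^ (3 : ℕ) + ‖T 1 x‖ₑ ^ (3 : ℕ) + ‖T 2 x‖ₑ ^ (3 : ℕ)) := by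
        refine lintegral_mono fun x => ?_
        exact (pow_le_pow_left' (enorm_sum_smul_single_le fun j => T j x) 3).trans (ennreal_add_three_pow_three_le _ _ _)
    _ = 16 * ((∫⁻ x in ball z 1, ‖T 0 x‖ₑ ^ (3 : ℕ)) + (∫⁻ x in ball z 1, ‖T 1 x‖ₑ ^ (3 : ℕ)) +
          ∫⁻ x in ball z 1, ‖T 2 x‖ₑ ^ (3 : ℕ)) := by
        have hm : ∀ j, AEMeasurable (fun x => ‖T j x‖ₑ ^ (3 : ℕ)) (volume.restrict (ball z 1)) := fun j => by
          obtain ⟨Cf, hCf⟩ := exists_holderWith_truncSource hv hR0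
          have hc : Continuous (T j) := (contDiff_one_newtonGradPotential _ hCf (by norm_num) (by norm_num)
            (hasCompactSupport_truncSource hR0 v)).continuous
          exact (hc.measurable.enorm.pow_const _).aemeasurable
        have hm01 : AEMeasurable (fun x => ‖T 0 x‖ₑ ^ (3 : ℕ) + ‖T 1 x‖ₑ ^ (3 : ℕ)) (volume.restrict (ball z 1)) :=
          (hm 0).add (hm 1)
        have hm012 : AEMeasurable (fun x => ‖T 0 x‖ₑ ^ (3 : ℕ) + ‖T 1 x‖ₑ ^ (3 : ℕ) + ‖T 2 x‖ₑ ^ (3 : ℕ))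
            (volume.restrict (ball z 1)) := hm01.add (hm 2)
        rw [lintegral_const_mul'' _ hm012, lintegral_add_left' hm01, lintegral_add_left' (hm 0)]
    _ ≤ 16 * (3 * (K * (ENNReal.ofReal (Cg ^ 3) * (1 + 8 * V ^ (2 : ℕ))) * τ)) := by
        rw [show (3 : ℝ≥0∞) * (K * (ENNReal.ofReal (Cg ^ 3) * (1 + 8 * V ^ (2 : ℕ))) * τ) =
          K * (ENNReal.ofReal (Cg ^ 3) * (1 + 8 * V ^ (2 : ℕ))) * τ + K * (ENNReal.ofReal (Cg ^ 3) * (1 + 8 * V ^ (2 : ℕ))) * τ +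
          K * (ENNReal.ofReal (Cg ^ 3) * (1 + 8 * V ^ (2 : ℕ))) * τ by ring]
        gcongr <;> exact hdir _
    _ = K₁ * τ := by rw [hK₁]; ring

/-- **The `L²` bound of the corrector** at a fixed radius `R > 0`: there is `K₂ < ∞` (depending on `R`)
with `∫ |F|² ≤ K₂ (∫_{B(0,2R+1)} |v|² + (∫_{B(0,2R+1)} |v|)²)` for every `C¹` field `v`. [folklore] -/
theorem exists_lintegral_newtonCorrector_sq_le (hR : 0 < R) :
    ∃ K₂ : ℝ≥0∞, K₂ < ⊤ ∧ ∀ v : EuclideanSpace ℝ (Fin 3) → EuclideanSpace ℝ (Fin 3), ContDiff ℝ 1 v →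
      ∫⁻ x, ‖∑ j : Fin 3, newtonGradPotential (EuclideanSpace.single j (1 : ℝ)) (fun y => fderiv ℝ (cutoff (E := EuclideanSpace ℝ (Fin 3)) R) y (v y)) x • EuclideanSpace.single j (1 : ℝ)‖ₑ ^ (2 : ℕ) ≤
        K₂ * ((∫⁻ x in ball (0 : EuclideanSpace ℝ (Fin 3)) (2 * R + 1), ‖v x‖ₑ ^ (2 : ℕ)) +
          (∫⁻ x in ball (0 : EuclideanSpace ℝ (Fin 3)) (2 * R + 1), ‖v x‖ₑ) ^ (2 : ℕ)) := by
  obtain ⟨KR, hKRt, hKR⟩ := exists_lintegral_newtonGradPotential_sq_le hR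
  obtain ⟨Cg, hCg0, hCg⟩ := exists_norm_fderiv_cutoff_le (E := EuclideanSpace ℝ (Fin 3))
  set cR : ℝ≥0∞ := ENNReal.ofReal (Cg / R) with hcR
  set K₂ : ℝ≥0∞ := 4 * (3 * (KR * cR ^ (2 : ℕ))) with hK₂
  refine ⟨K₂, ?_, ?_⟩
  · exact ENNReal.mul_lt_top ENNReal.ofNat_lt_top (ENNReal.mul_lt_top ENNReal.ofNat_lt_top
      (ENNReal.mul_lt_top hKRt (ENNReal.pow_lt_top ENNReal.ofReal_lt_top)))
  intro v hv
  set g : EuclideanSpace ℝ (Fin 3) → ℝ := fun y => fderiv ℝ (cutoff (E := EuclideanSpace ℝ (Fin 3)) R) y (v y) with hg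
  have hgc : Continuous g := (contDiff_truncSource hv R).continuous
  have hsupp : tsupport g ⊆ closedBall (0 : EuclideanSpace ℝ (Fin 3)) (2 * R) := (tsupport_truncSource_subset hR v).trans inter_subset_right
  -- the sizes of `g`
  set S : Set (EuclideanSpace ℝ (Fin 3)) := ball (0 : EuclideanSpace ℝ (Fin 3)) (2 * R + 1) with hS
  have hind : ∀ y, ‖g y‖ₑ ≤ cR * S.indicator (fun y => ‖v y‖ₑ) y := by
    intro y
    by_cases hgy : g y = 0
    · rw [hgy, enorm_zero]; exact zero_le
    · have hyS : y ∈ S := by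
        rw [hS, mem_ball_zero_iff]
        linarith [norm_le_of_truncSource_ne_zero (v := v) hR hgy]
      rw [indicator_of_mem hyS]
      refine (enorm_truncSource_le hCg hR y).trans (mul_le_mul' le_rfl ?_)
      by_cases hy : y ∈ {y : EuclideanSpace ℝ (Fin 3) | R ≤ ‖y‖}
      · rw [indicator_of_mem hy]
      · rw [indicator_of_notMem hy]; exact zero_le
  set X₂ : ℝ≥0∞ := ∫⁻ x in S, ‖v x‖ₑ ^ (2 : ℕ) with hX₂
  set X₁ : ℝ≥0∞ := ∫⁻ x in S, ‖v x‖ₑ with hX₁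
  have hg2 : ∫⁻ y, ‖g y‖ₑ ^ (2 : ℕ) ≤ cR ^ (2 : ℕ) * X₂ := by
    calc ∫⁻ y, ‖g y‖ₑ ^ (2 : ℕ) ≤ ∫⁻ y, (cR * S.indicator (fun y => ‖v y‖ₑ) y) ^ (2 : ℕ) :=
          lintegral_mono fun y => pow_le_pow_left' (hind y) 2
      _ = cR ^ (2 : ℕ) * ∫⁻ y, S.indicator (fun y => ‖v y‖ₑ ^ (2 : ℕ)) y := by
          simp_rw [mul_pow]
          rw [lintegral_const_mul' _ _ (ENNReal.pow_ne_top ENNReal.ofReal_ne_top)]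
          congr 1
          refine lintegral_congr fun y => ?_
          by_cases hy : y ∈ S
          · rw [indicator_of_mem hy, indicator_of_mem hy]
          · rw [indicator_of_notMem hy, indicator_of_notMem hy, zero_pow two_ne_zero]
      _ = cR ^ (2 : ℕ) * X₂ := by rw [lintegral_indicator measurableSet_ball]
  have hg1 : ∫⁻ y, ‖g y‖ₑ ≤ cR * X₁ := by
    calc ∫⁻ y, ‖g y‖ₑ ≤ ∫⁻ y, cR * S.indicator (fun y => ‖v y‖ₑ) y := lintegral_mono hind
      _ = cR * X₁ := by
          rw [lintegral_const_mul' _ _ ENNReal.ofReal_ne_top, lintegral_indicator measurableSet_ball]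
  -- each direction
  have hdir : ∀ j : Fin 3, ∫⁻ x, ‖newtonGradPotential (EuclideanSpace.single j (1 : ℝ)) g x‖ₑ ^ (2 : ℕ) ≤
      KR * cR ^ (2 : ℕ) * (X₂ + X₁ ^ (2 : ℕ)) := by
    intro j
    have h := hKR g (EuclideanSpace.single j (1 : ℝ)) hgc hsupp
    have e1 : ‖EuclideanSpace.single j (1 : ℝ)‖ₑ = 1 := by
      rw [← ofReal_norm, PiLp.norm_single, norm_one, ENNReal.ofReal_one]
    rw [e1, one_pow, one_mul] at h
    calc _ ≤ KR * ((∫⁻ y, ‖g y‖ₑ ^ (2 : ℕ)) + (∫⁻ y, ‖g y‖ₑ) ^ (2 : ℕ)) := h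
      _ ≤ KR * (cR ^ (2 : ℕ) * X₂ + (cR * X₁) ^ (2 : ℕ)) := by gcongr
      _ = KR * cR ^ (2 : ℕ) * (X₂ + X₁ ^ (2 : ℕ)) := by ring
  -- summing the three directions: `(a+b+c)² ≤ 4(a²+b²+c²)`
  have hsq : ∀ p q : ℝ≥0∞, (p + q) ^ (2 : ℕ) ≤ 2 * (p ^ (2 : ℕ) + q ^ (2 : ℕ)) := fun p q => by
    have h := ENNReal.rpow_add_le_mul_rpow_add_rpow p q (by norm_num : (1 : ℝ) ≤ 2)
    have e2 : (2 : ℝ≥0∞) ^ ((2 : ℝ) - 1) = 2 := by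
      rw [show (2 : ℝ) - 1 = ((1 : ℕ) : ℝ) by norm_num, ENNReal.rpow_natCast, pow_one]
    have e3 : ∀ w : ℝ≥0∞, w ^ (2 : ℝ) = w ^ (2 : ℕ) := fun w => by
      rw [show (2 : ℝ) = ((2 : ℕ) : ℝ) by norm_num, ENNReal.rpow_natCast]
    simpa only [e2, e3] using h
  have hsq3 : ∀ p q r : ℝ≥0∞, (p + q + r) ^ (2 : ℕ) ≤ 4 * (p ^ (2 : ℕ) + q ^ (2 : ℕ) + r ^ (2 : ℕ)) := by
    intro p q r
    calc (p + q + r) ^ (2 : ℕ) = (p + (q + r)) ^ (2 : ℕ) := by rw [add_assoc]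
      _ ≤ 2 * (p ^ (2 : ℕ) + (q + r) ^ (2 : ℕ)) := hsq _ _
      _ ≤ 2 * (p ^ (2 : ℕ) + 2 * (q ^ (2 : ℕ) + r ^ (2 : ℕ))) := by gcongr; exact hsq _ _
      _ ≤ 2 * (2 * p ^ (2 : ℕ) + 2 * (q ^ (2 : ℕ) + r ^ (2 : ℕ))) := by
          gcongr; exact le_mul_of_one_le_left' (by norm_num)
      _ = 4 * (p ^ (2 : ℕ) + q ^ (2 : ℕ) + r ^ (2 : ℕ)) := by ring
  set T : Fin 3 → EuclideanSpace ℝ (Fin 3) → ℝ := fun j x => newtonGradPotential (EuclideanSpace.single j (1 : ℝ)) g x with hT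
  have hm : ∀ j, AEMeasurable (fun x => ‖T j x‖ₑ ^ (2 : ℕ)) volume := fun j => by
    obtain ⟨Cf, hCf⟩ := exists_holderWith_truncSource hv hR
    have hc : Continuous (T j) := (contDiff_one_newtonGradPotential _ hCf (by norm_num) (by norm_num)
      (hasCompactSupport_truncSource hR v)).continuous
    exact (hc.measurable.enorm.pow_const _).aemeasurable
  calc ∫⁻ x, ‖∑ j : Fin 3, newtonGradPotential (EuclideanSpace.single j (1 : ℝ)) (fun y => fderiv ℝ (cutoff (E := EuclideanSpace ℝ (Fin 3)) R) y (v y)) x • EuclideanSpace.single j (1 : ℝ)‖ₑ ^ (2 : ℕ)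
      ≤ ∫⁻ x, 4 * (‖T 0 x‖ₑ ^ (2 : ℕ) + ‖T 1 x‖ₑ ^ (2 : ℕ) + ‖T 2 x‖ₑ ^ (2 : ℕ)) := by
        refine lintegral_mono fun x => ?_
        exact (pow_le_pow_left' (enorm_sum_smul_single_le fun j => T j x) 2).trans (hsq3 _ _ _)
    _ = 4 * ((∫⁻ x, ‖T 0 x‖ₑ ^ (2 : ℕ)) + (∫⁻ x, ‖T 1 x‖ₑ ^ (2 : ℕ)) + ∫⁻ x, ‖T 2 x‖ₑ ^ (2 : ℕ)) := by
        have hm01 : AEMeasurable (fun x => ‖T 0 x‖ₑ ^ (2 : ℕ) + ‖T 1 x‖ₑ ^ (2 : ℕ)) volume := (hm 0).add (hm 1)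
        have hm012 : AEMeasurable (fun x => ‖T 0 x‖ₑ ^ (2 : ℕ) + ‖T 1 x‖ₑ ^ (2 : ℕ) + ‖T 2 x‖ₑ ^ (2 : ℕ)) volume :=
          hm01.add (hm 2)
        rw [lintegral_const_mul'' _ hm012, lintegral_add_left' hm01, lintegral_add_left' (hm 0)]
    _ ≤ 4 * (3 * (KR * cR ^ (2 : ℕ) * (X₂ + X₁ ^ (2 : ℕ)))) := by
        rw [show (3 : ℝ≥0∞) * (KR * cR ^ (2 : ℕ) * (X₂ + X₁ ^ (2 : ℕ))) =
          KR * cR ^ (2 : ℕ) * (X₂ + X₁ ^ (2 : ℕ)) + KR * cR ^ (2 : ℕ) * (X₂ + X₁ ^ (2 : ℕ)) +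
          KR * cR ^ (2 : ℕ) * (X₂ + X₁ ^ (2 : ℕ)) by ring]
        gcongr <;> exact hdir _
    _ = K₂ * (X₂ + X₁ ^ (2 : ℕ)) := by rw [hK₂]; ring

/-- **The truncation is bounded** (the cut-off part is continuous with compact support; each
`T_{eⱼ}[g]` is bounded by Majda–Bertozzi's sup bound `exists_newtonGradPotential_bounds` for the
Hölder source `g`). [folklore] -/
theorem exists_norm_divFreeTruncation_le (hv : ContDiff ℝ 1 v) (hR : 0 < R) :
    ∃ M : ℝ, ∀ x : EuclideanSpace ℝ (Fin 3), ‖cutoff (E := EuclideanSpace ℝ (Fin 3)) R x • v x - ∑ j : Fin 3, newtonGradPotential (EuclideanSpace.single j (1 : ℝ)) (fun y => fderiv ℝ (cutoff (E := EuclideanSpace ℝ (Fin 3)) R) y (v y)) x • EuclideanSpace.single j (1 : ℝ)‖ ≤ M := by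
  set g : EuclideanSpace ℝ (Fin 3) → ℝ := fun y => fderiv ℝ (cutoff (E := EuclideanSpace ℝ (Fin 3)) R) y (v y) with hg
  have hgc : Continuous g := (contDiff_truncSource hv R).continuous
  have hgcs : HasCompactSupport g := hasCompactSupport_truncSource hR v
  have hsupp : tsupport g ⊆ closedBall (0 : EuclideanSpace ℝ (Fin 3)) (2 * R) := (tsupport_truncSource_subset hR v).trans inter_subset_right
  obtain ⟨Cf, hCf⟩ := exists_holderWith_truncSource hv hR
  obtain ⟨Mg, hMg⟩ := hgc.bounded_above_of_compact_support hgcs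
  obtain ⟨C, hC0, hC⟩ := exists_newtonGradPotential_bounds (F := ℝ)
  have hT : ∀ j : Fin 3, ∀ x, ‖newtonGradPotential (EuclideanSpace.single j (1 : ℝ)) g x‖ ≤ C * 1 * Mg * (1 + (2 * R) ^ 3) := by
    intro j x
    have h := (hC (EuclideanSpace.single j (1 : ℝ)) g Cf (1 / 2) Mg (2 * R) 0 hCf (by norm_num) (by norm_num) hMg hsupp
      (by positivity)).1 x
    rwa [PiLp.norm_single, norm_one] at h
  -- the cut-off part
  have hcont : Continuous fun x => cutoff (E := EuclideanSpace ℝ (Fin 3)) R x • v x :=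
    (contDiff_cutoff (n := 0) R).continuous.smul hv.continuous
  have hcs : HasCompactSupport fun x => cutoff (E := EuclideanSpace ℝ (Fin 3)) R x • v x :=
    (hasCompactSupport_cutoff hR).smul_right
  obtain ⟨M₁, hM₁⟩ := hcont.bounded_above_of_compact_support hcs
  refine ⟨M₁ + 3 * (C * 1 * Mg * (1 + (2 * R) ^ 3)), fun x => ?_⟩
  refine (norm_sub_le _ _).trans (add_le_add (hM₁ x) ?_)
  refine (norm_sum_le _ _).trans ?_
  calc ∑ j : Fin 3, ‖newtonGradPotential (EuclideanSpace.single j (1 : ℝ)) g x • EuclideanSpace.single j (1 : ℝ)‖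
      = ∑ j : Fin 3, ‖newtonGradPotential (EuclideanSpace.single j (1 : ℝ)) g x‖ := by
        refine Finset.sum_congr rfl fun j _ => ?_
        rw [norm_smul, PiLp.norm_single, norm_one, mul_one]
    _ ≤ ∑ _j : Fin 3, C * 1 * Mg * (1 + (2 * R) ^ 3) := Finset.sum_le_sum fun j _ => hT j x
    _ = 3 * (C * 1 * Mg * (1 + (2 * R) ^ 3)) := by simp [Finset.sum_const, Finset.card_univ]

end Corrector

/-! ### The splitting of a uniformly locally `L³` divergence-free field vanishing at infinity -/

section Splitting

open scoped Convolution
open ContinuousLinearMap (lsmul)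

/-- **Decay at infinity, quantified**: if `∫_{B(x₀,1)} |a|³ → 0` as `|x₀| → ∞` then for every `η > 0`
there is `r ≥ 0` with `∫_{B(c,1)} |a|³ ≤ η` whenever `‖c‖ ≥ r`. [folklore] -/
theorem exists_radius_forall_lintegral_ball_le_of_tendsto_cocompact {f : EuclideanSpace ℝ (Fin 3) → ℝ≥0∞}
    (hf : Tendsto f (cocompact (EuclideanSpace ℝ (Fin 3))) (𝓝 0)) {η : ℝ≥0∞} (hη : 0 < η) :
    ∃ r : ℝ, 0 ≤ r ∧ ∀ c : EuclideanSpace ℝ (Fin 3), r ≤ ‖c‖ → f c ≤ η := by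
  have hev : ∀ᶠ c in cocompact (EuclideanSpace ℝ (Fin 3)), f c < η := hf (gt_mem_nhds hη)
  obtain ⟨K, hK, hKs⟩ := mem_cocompact.1 hev
  obtain ⟨r, hr⟩ := hK.isBounded.subset_closedBall (0 : EuclideanSpace ℝ (Fin 3))
  refine ⟨max r 0 + 1, by positivity, fun c hc => ?_⟩
  have hcK : c ∉ K := fun h => by
    have := mem_closedBall_zero_iff.1 (hr h)
    linarith [le_max_left r 0]
  exact (hKs hcK).le

set_option maxHeartbeats 6400000 in
/-- **Splitting of a divergence-free `L³_uloc` field vanishing at infinity into a uniformly small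
part and a finite-energy part, along divergence-free `L² ∩ L³` approximations** (Lemarié-Rieusset
2016, Thm. 14.8, proof, Step 2, PDF p. 524: "we decompose `u₁(t₁,.)` in `α + β` with `α` small in
`E³_σ` and `β ∈ E³_{comp,σ}`"; Seregin 2014, App. B §B.5, p. 165: "using density of smooth
functions, let us decompose `v(·,t₀) = a₁ + a₂` … `‖a₁‖_{L_{3,unif}} ≤ ε`, `a₂ ∈ C̊₀^∞`"). Let `a`
be measurable and weakly divergence free with `∫_{B(x₀,1)} |a|³ ≤ A` for all `x₀` and
`∫_{B(x₀,1)} |a|³ → 0` as `|x₀| → ∞`, and let `ε > 0`. Then there are fields `α_k, β_k` (`k ∈ ℕ`)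
such that: every `α_k` is measurable, bounded, in `L² ∩ L³`, weakly divergence free, with
`‖α_k‖_{L³(B(z,1))} ≤ ε` for every centre `z`; every `β_k` is measurable, bounded, in `L² ∩ L³`,
weakly divergence free, and `α_k + β_k` is weakly divergence free; the `β_k` are bounded in `L²`
uniformly in `k`; and `α_k + β_k → a` in `L²(B(0,ρ))` for every `ρ > 0`. (Construction: mollify,
`ã_k = φ̃_k ⋆ a`; truncate with the Newtonian corrector of `DivFreeL3Approximation.lean` at the radii
`R₀ + k + 1` and `R₀`; `β_k` is the truncation at `R₀`, `α_k` the difference; `R₀` is chosen by the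
decay of `a` so that `ã_k` and both correctors are small in `L³_uloc` on `‖x‖ ≥ R₀`,
`exists_lintegral_unitBall_newtonCorrector_cube_le`.)
[cite: LemarieRieusset2016, Thm. 14.8 proof Step 2 (PDF p. 524)] [cite: Seregin2014Notes, App. B §B.5 (p. 165)] -/
theorem exists_uloc_solenoidal_splitting
    {a : EuclideanSpace ℝ (Fin 3) → EuclideanSpace ℝ (Fin 3)} (ham : AEStronglyMeasurable a volume)
    (hdiv : IsWeaklyDivFree a) {A : ℝ≥0}
    (hA : ∀ x₀ : EuclideanSpace ℝ (Fin 3), ∫⁻ x in ball x₀ 1, ‖a x‖ₑ ^ (3 : ℕ) ≤ A)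
    (hdecay : Tendsto (fun x₀ : EuclideanSpace ℝ (Fin 3) => ∫⁻ x in ball x₀ 1, ‖a x‖ₑ ^ (3 : ℕ))
      (cocompact (EuclideanSpace ℝ (Fin 3))) (𝓝 0))
    {ε : ℝ} (hε : 0 < ε) :
    ∃ α β : ℕ → EuclideanSpace ℝ (Fin 3) → EuclideanSpace ℝ (Fin 3),
      (∀ k, AEStronglyMeasurable (α k) volume ∧ (∃ M : ℝ, ∀ x, ‖α k x‖ ≤ M) ∧ MemLp (α k) 3 volume ∧
        MemLp (α k) 2 volume ∧ IsWeaklyDivFree (α k) ∧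
        ∀ z : EuclideanSpace ℝ (Fin 3), eLpNorm (α k) 3 (volume.restrict (ball z 1)) ≤ ENNReal.ofReal ε) ∧
      (∀ k, AEStronglyMeasurable (β k) volume ∧ (∃ M : ℝ, ∀ x, ‖β k x‖ ≤ M) ∧ MemLp (β k) 3 volume ∧
        MemLp (β k) 2 volume ∧ IsWeaklyDivFree (β k) ∧ IsWeaklyDivFree (α k + β k)) ∧
      (∃ Cβ : ℝ≥0∞, Cβ < ⊤ ∧ ∀ k, ∫⁻ x, ‖β k x‖ₑ ^ (2 : ℕ) ≤ Cβ) ∧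
      ∀ ρ : ℝ, 0 < ρ → Tendsto (fun k => ∫⁻ x in ball (0 : EuclideanSpace ℝ (Fin 3)) ρ,
        ‖α k x + β k x - a x‖ₑ ^ (2 : ℕ)) atTop (𝓝 0) := by
  ------------------------------------------------------------------
  -- ## Step 0: constants
  ------------------------------------------------------------------
  obtain ⟨K₁, hK₁t, hK₁⟩ := exists_lintegral_unitBall_newtonCorrector_cube_le
  obtain ⟨F₂, hF₂n, hF₂⟩ := exists_finset_norm_lt_ball_two_subset
  set V : ℝ≥0∞ := volume (ball (0 : EuclideanSpace ℝ (Fin 3)) 1) with hV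
  have hVt : V ≠ ⊤ := measure_ball_lt_top.ne
  have hAt : (A : ℝ≥0∞) ≠ ⊤ := ENNReal.coe_ne_top
  have haLI : LocallyIntegrable a volume := locallyIntegrable_of_forall_lintegral_ball_cube_le ham hAt hA
  ------------------------------------------------------------------
  -- ## Step 1: the mollifications `ã_k`
  ------------------------------------------------------------------
  set φ : ℕ → ContDiffBump (0 : EuclideanSpace ℝ (Fin 3)) := fun k =>
    ⟨1 / ((k : ℝ) + 2), 1 / ((k : ℝ) + 1), by positivity,
      one_div_lt_one_div_of_lt (by positivity) (by linarith)⟩ with hφ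
  have hφrOut : ∀ k, (φ k).rOut = 1 / ((k : ℝ) + 1) := fun k => rfl
  have hφ1 : ∀ k, (φ k).rOut ≤ 1 := fun k => by
    rw [hφrOut, div_le_one (by positivity)]; linarith [k.cast_nonneg (α := ℝ)]
  have hφlim : Tendsto (fun k => (φ k).rOut) atTop (𝓝 0) := by
    simp_rw [hφrOut]; exact tendsto_one_div_add_atTop_nhds_zero_nat
  set at' : ℕ → EuclideanSpace ℝ (Fin 3) → EuclideanSpace ℝ (Fin 3) := fun k =>
    (φ k).normed volume ⋆[lsmul ℝ ℝ, volume] a with hat'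
  have hC1 : ∀ k, ContDiff ℝ 1 (at' k) := fun k =>
    contDiff_normed_convolution_of_locallyIntegrable (φ k) haLI (n := 1)
  have hcont : ∀ k, Continuous (at' k) := fun k => (hC1 k).continuous
  have hdivk : ∀ k, VectorCalculus.IsDivFree (at' k) := fun k =>
    isDivFree_normed_convolution_of_isWeaklyDivFree (φ k) haLI hdiv
  -- uniformly local cube bounds of `ã_k`: global and in the decay region
  have hcube : ∀ k (c : EuclideanSpace ℝ (Fin 3)) {B : ℝ≥0∞},
      (∀ c' ∈ F₂, ∫⁻ x in ball (c + c') 1, ‖a x‖ₑ ^ (3 : ℕ) ≤ B) →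
      ∫⁻ x in ball c 1, ‖at' k x‖ₑ ^ (3 : ℕ) ≤ F₂.card * B := by
    intro k c B hB
    calc ∫⁻ x in ball c 1, ‖at' k x‖ₑ ^ (3 : ℕ) ≤ ∫⁻ x in ball c (1 + 1), ‖a x‖ₑ ^ (3 : ℕ) :=
          lintegral_ball_cube_normed_convolution_le (φ k) (hφ1 k) ham c 1
      _ = ∫⁻ x in ball c 2, ‖a x‖ₑ ^ (3 : ℕ) := by norm_num
      _ ≤ F₂.card * B := lintegral_ball_two_le_card_mul hF₂ _ c hB
  have hcubeA : ∀ k (c : EuclideanSpace ℝ (Fin 3)), ∫⁻ x in ball c 1, ‖at' k x‖ₑ ^ (3 : ℕ) ≤ F₂.card * A :=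
    fun k c => hcube k c fun c' _ => hA _
  have hcubeDecay : ∀ k {η : ℝ≥0∞} {r : ℝ},
      (∀ c : EuclideanSpace ℝ (Fin 3), r ≤ ‖c‖ → ∫⁻ x in ball c 1, ‖a x‖ₑ ^ (3 : ℕ) ≤ η) →
      ∀ c : EuclideanSpace ℝ (Fin 3), r + 3 ≤ ‖c‖ → ∫⁻ x in ball c 1, ‖at' k x‖ₑ ^ (3 : ℕ) ≤ F₂.card * η := by
    intro k η r hr c hc
    refine hcube k c fun c' hc' => hr _ ?_
    have h3 := hF₂n c' hc'
    have : ‖c‖ - ‖c'‖ ≤ ‖c + c'‖ := by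
      have := norm_sub_norm_le c (-c')
      rw [norm_neg, sub_neg_eq_add] at this
      exact this
    linarith
  ------------------------------------------------------------------
  -- ## Step 2: the radius `R₀` from the decay
  ------------------------------------------------------------------
  set D : ℝ≥0∞ := (K₁ + 1) * F₂.card + 1 with hD
  have hD0 : D ≠ 0 := by rw [hD]; exact ne_of_gt (lt_of_lt_of_le zero_lt_one le_add_self)
  have hDt : D ≠ ⊤ := ENNReal.add_ne_top.2
    ⟨ENNReal.mul_ne_top (ENNReal.add_ne_top.2 ⟨hK₁t.ne, ENNReal.one_ne_top⟩) (ENNReal.natCast_ne_top _), ENNReal.one_ne_top⟩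
  set e3 : ℝ≥0∞ := ENNReal.ofReal ε / 3 with he3
  set η₀ : ℝ≥0∞ := e3 ^ (3 : ℕ) / D with hη₀
  have hε0 : 0 < ENNReal.ofReal ε := ENNReal.ofReal_pos.2 hε
  have he30 : 0 < e3 := ENNReal.div_pos hε0.ne' (by norm_num)
  have hη₀pos : 0 < η₀ := ENNReal.div_pos (ENNReal.pow_pos he30 3).ne' hDt
  have hDη₀ : D * η₀ = e3 ^ (3 : ℕ) := ENNReal.mul_div_cancel hD0 hDt
  obtain ⟨r₀, hr₀0, hr₀⟩ := exists_radius_forall_lintegral_ball_le_of_tendsto_cocompact hdecay hη₀pos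
  set R₀ : ℝ := r₀ + 4 with hR₀
  have hR₀1 : 1 ≤ R₀ := by rw [hR₀]; linarith
  have hR₀pos : 0 < R₀ := one_pos.trans_le hR₀1
  -- in the decay region: for `R ≥ R₀`, `ã_k` and the corrector at radius `R` are small
  have hsmall_at : ∀ k (R : ℝ), R₀ ≤ R → ∀ c : EuclideanSpace ℝ (Fin 3), R - 1 ≤ ‖c‖ →
      ∫⁻ x in ball c 1, ‖at' k x‖ₑ ^ (3 : ℕ) ≤ F₂.card * η₀ := by
    intro k R hR c hc
    exact hcubeDecay k hr₀ c (by rw [hR₀] at hR; linarith)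
  have hsmall_corr : ∀ k (R : ℝ), R₀ ≤ R → ∀ z : EuclideanSpace ℝ (Fin 3),
      ∫⁻ x in ball z 1, ‖∑ j : Fin 3, newtonGradPotential (EuclideanSpace.single j (1 : ℝ)) (fun y => fderiv ℝ (cutoff (E := EuclideanSpace ℝ (Fin 3)) R) y (at' k y)) x • EuclideanSpace.single j (1 : ℝ)‖ₑ ^ (3 : ℕ) ≤ K₁ * (F₂.card * η₀) :=
    fun k R hR z => hK₁ (at' k) R (F₂.card * η₀) (hC1 k) (hR₀1.trans hR) (hsmall_at k R hR) z
  have hη₁ : (F₂.card : ℝ≥0∞) * η₀ ≤ e3 ^ (3 : ℕ) := by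
    rw [← hDη₀]
    refine mul_le_mul' ?_ le_rfl
    rw [hD]
    calc (F₂.card : ℝ≥0∞) = 1 * F₂.card := (one_mul _).symm
      _ ≤ (K₁ + 1) * F₂.card := by gcongr; exact le_add_self
      _ ≤ (K₁ + 1) * F₂.card + 1 := le_self_add
  have hη₂ : K₁ * ((F₂.card : ℝ≥0∞) * η₀) ≤ e3 ^ (3 : ℕ) := by
    rw [← hDη₀, ← mul_assoc]
    refine mul_le_mul' ?_ le_rfl
    rw [hD]
    calc K₁ * (F₂.card : ℝ≥0∞) ≤ (K₁ + 1) * F₂.card := by gcongr; exact le_self_add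
      _ ≤ (K₁ + 1) * F₂.card + 1 := le_self_add
  ------------------------------------------------------------------
  -- ## Step 3: the truncations, `β_k`, `α_k`
  ------------------------------------------------------------------
  set Rk : ℕ → ℝ := fun k => R₀ + ((k : ℝ) + 1) with hRk
  have hRk : ∀ k, R₀ ≤ Rk k := fun k => by simp only [hRk]; linarith [k.cast_nonneg (α := ℝ)]
  have hRkpos : ∀ k, 0 < Rk k := fun k => hR₀pos.trans_le (hRk k)
  set TR : ℕ → ℝ → EuclideanSpace ℝ (Fin 3) → EuclideanSpace ℝ (Fin 3) := fun k R x => cutoff (E := EuclideanSpace ℝ (Fin 3)) R x • at' k x - ∑ j : Fin 3, newtonGradPotential (EuclideanSpace.single j (1 : ℝ)) (fun y => fderiv ℝ (cutoff (E := EuclideanSpace ℝ (Fin 3)) R) y (at' k y)) x • EuclideanSpace.single j (1 : ℝ) with hTR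
  set CO : ℕ → ℝ → EuclideanSpace ℝ (Fin 3) → EuclideanSpace ℝ (Fin 3) := fun k R x => ∑ j : Fin 3, newtonGradPotential (EuclideanSpace.single j (1 : ℝ)) (fun y => fderiv ℝ (cutoff (E := EuclideanSpace ℝ (Fin 3)) R) y (at' k y)) x • EuclideanSpace.single j (1 : ℝ) with hCO
  set β : ℕ → EuclideanSpace ℝ (Fin 3) → EuclideanSpace ℝ (Fin 3) := fun k => TR k R₀ with hβ
  set α : ℕ → EuclideanSpace ℝ (Fin 3) → EuclideanSpace ℝ (Fin 3) := fun k => TR k (Rk k) - TR k R₀ with hα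
  -- the tree's facts on the truncation
  have hTRcont : ∀ k R, 0 < R → Continuous (TR k R) := fun k R hR =>
    (contDiff_divFreeTruncation (hC1 k) hR).continuous
  have hTRm : ∀ k R, 0 < R → AEStronglyMeasurable (TR k R) volume := fun k R hR =>
    (hTRcont k R hR).aestronglyMeasurable
  have hTR3 : ∀ k R, 0 < R → MemLp (TR k R) 3 volume := fun k R hR => memLp_three_divFreeTruncation (hC1 k) hR
  have hTR2 : ∀ k R, 0 < R → MemLp (TR k R) 2 volume := fun k R hR => memLp_two_divFreeTruncation (hC1 k) hR
  have hTRdiv : ∀ k R, 0 < R → IsWeaklyDivFree (TR k R) := fun k R hR =>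
    isWeaklyDivFree_divFreeTruncation (hC1 k) (hdivk k) hR
  have hTRbd : ∀ k R, 0 < R → ∃ M : ℝ, ∀ x, ‖TR k R x‖ ≤ M := fun k R hR =>
    exists_norm_divFreeTruncation_le (hC1 k) hR
  have hCOcont : ∀ k R, 0 < R → Continuous (CO k R) := by
    intro k R hR
    obtain ⟨Cf, hCf⟩ := exists_holderWith_truncSource (hC1 k) hR
    refine continuous_finsetSum _ fun j _ => ?_
    exact ((contDiff_one_newtonGradPotential _ hCf (by norm_num) (by norm_num)
      (hasCompactSupport_truncSource hR (at' k))).continuous).smul continuous_const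
  have hαβ : ∀ k, α k + β k = TR k (Rk k) := fun k => by simp only [hα, hβ, sub_add_cancel]
  refine ⟨α, β, fun k => ⟨?_, ?_, ?_, ?_, ?_, ?_⟩, fun k => ⟨hTRm k R₀ hR₀pos, hTRbd k R₀ hR₀pos, hTR3 k R₀ hR₀pos,
    hTR2 k R₀ hR₀pos, hTRdiv k R₀ hR₀pos, by rw [hαβ]; exact hTRdiv k _ (hRkpos k)⟩, ?_, ?_⟩
  · exact (hTRm k _ (hRkpos k)).sub (hTRm k R₀ hR₀pos)
  · obtain ⟨M₁, hM₁⟩ := hTRbd k (Rk k) (hRkpos k)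
    obtain ⟨M₂, hM₂⟩ := hTRbd k R₀ hR₀pos
    exact ⟨M₁ + M₂, fun x => (norm_sub_le _ _).trans (add_le_add (hM₁ x) (hM₂ x))⟩
  · exact (hTR3 k _ (hRkpos k)).sub (hTR3 k R₀ hR₀pos)
  · exact (hTR2 k _ (hRkpos k)).sub (hTR2 k R₀ hR₀pos)
  · -- `α_k` is `C¹` and divergence free
    have hC1T : ∀ R, 0 < R → ContDiff ℝ 1 (TR k R) := fun R hR => contDiff_divFreeTruncation (hC1 k) hR
    have hdf : VectorCalculus.IsDivFree (TR k (Rk k) - TR k R₀) := fun x => by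
      rw [show TR k (Rk k) - TR k R₀ = fun y => TR k (Rk k) y - TR k R₀ y from rfl,
        divergence_sub_apply (((hC1T _ (hRkpos k)).differentiable one_ne_zero) x) (((hC1T R₀ hR₀pos).differentiable one_ne_zero) x),
        isDivFree_divFreeTruncation (hC1 k) (hdivk k) (hRkpos k) x, isDivFree_divFreeTruncation (hC1 k) (hdivk k) hR₀pos x,
        sub_zero]
    exact VectorCalculus.IsDivFree.isWeaklyDivFree_holds hdf ((hC1T _ (hRkpos k)).sub (hC1T R₀ hR₀pos))
  ------------------------------------------------------------------
  -- ## Step 4: `α_k` is uniformly small in `L³_uloc`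
  ------------------------------------------------------------------
  · intro z
    set μ : Measure (EuclideanSpace ℝ (Fin 3)) := volume.restrict (ball z 1) with hμ
    -- the annular part `d = (χ_{R_k} - χ_{R₀}) ã_k`
    set d : EuclideanSpace ℝ (Fin 3) → EuclideanSpace ℝ (Fin 3) := fun x =>
      (cutoff (E := EuclideanSpace ℝ (Fin 3)) (Rk k) x - cutoff (E := EuclideanSpace ℝ (Fin 3)) R₀ x) • at' k x with hd
    have hdcont : Continuous d := ((contDiff_cutoff (n := 0) (Rk k)).continuous.sub
      (contDiff_cutoff (n := 0) R₀).continuous).smul (hcont k)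
    have hαeq : α k = (d - CO k (Rk k)) + CO k R₀ := by
      funext x
      simp only [hα, hTR, hCO, hd, Pi.sub_apply, Pi.add_apply, sub_smul]
      abel
    -- `eLpNorm` from cube integrals
    have heL : ∀ f : EuclideanSpace ℝ (Fin 3) → EuclideanSpace ℝ (Fin 3),
        eLpNorm f 3 μ = (∫⁻ x, ‖f x‖ₑ ^ (3 : ℕ) ∂μ) ^ (1 / 3 : ℝ) := fun f => by
      have e : ∀ w : ℝ≥0∞, w ^ (3 : ℕ) = w ^ (3 : ℝ) := fun w => by rw [← ENNReal.rpow_natCast]; norm_num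
      simp_rw [e]
      rw [lintegral_enorm_rpow_three_eq_eLpNorm_rpow, ← ENNReal.rpow_mul]; norm_num
    have hroot : ∀ {X : ℝ≥0∞}, X ≤ e3 ^ (3 : ℕ) → X ^ (1 / 3 : ℝ) ≤ e3 := fun {X} hX => by
      calc X ^ (1 / 3 : ℝ) ≤ (e3 ^ (3 : ℕ)) ^ (1 / 3 : ℝ) := ENNReal.rpow_le_rpow hX (by norm_num)
        _ = e3 := by rw [← ENNReal.rpow_natCast, ← ENNReal.rpow_mul]; norm_num
    -- (a) the annular part
    have hdle : ∀ x, ‖d x‖ₑ ≤ {y : EuclideanSpace ℝ (Fin 3) | R₀ ≤ ‖y‖}.indicator (fun y => ‖at' k y‖ₑ) x := by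
      intro x
      by_cases hx : R₀ ≤ ‖x‖
      · rw [indicator_of_mem (show x ∈ {y : EuclideanSpace ℝ (Fin 3) | R₀ ≤ ‖y‖} from hx), hd, enorm_smul]
        refine mul_le_of_le_one_left' ?_
        rw [← ofReal_norm, Real.norm_eq_abs, ← ENNReal.ofReal_one]
        refine ENNReal.ofReal_le_ofReal ?_
        have h1 := cutoff_nonneg (E := EuclideanSpace ℝ (Fin 3)) (Rk k) x
        have h2 := cutoff_le_one (E := EuclideanSpace ℝ (Fin 3)) (Rk k) x
        have h3 := cutoff_nonneg (E := EuclideanSpace ℝ (Fin 3)) R₀ x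
        have h4 := cutoff_le_one (E := EuclideanSpace ℝ (Fin 3)) R₀ x
        rw [abs_sub_le_iff]; constructor <;> linarith
      · have h0 : d x = 0 := by
          rw [not_le] at hx
          simp only [hd, cutoff_eq_one (hRkpos k) (hx.le.trans (hRk k)), cutoff_eq_one hR₀pos hx.le, sub_self, zero_smul]
        rw [h0, enorm_zero]; exact zero_le
    have hd3 : ∫⁻ x, ‖d x‖ₑ ^ (3 : ℕ) ∂μ ≤ F₂.card * η₀ := by
      by_cases hz : R₀ - 1 ≤ ‖z‖
      · calc ∫⁻ x, ‖d x‖ₑ ^ (3 : ℕ) ∂μ ≤ ∫⁻ x, ‖at' k x‖ₑ ^ (3 : ℕ) ∂μ := by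
              refine lintegral_mono fun x => pow_le_pow_left' ((hdle x).trans ?_) 3
              by_cases hx : x ∈ {y : EuclideanSpace ℝ (Fin 3) | R₀ ≤ ‖y‖}
              · rw [indicator_of_mem hx]
              · rw [indicator_of_notMem hx]; exact zero_le
          _ ≤ F₂.card * η₀ := hsmall_at k R₀ le_rfl z hz
      · have h0 : ∀ x ∈ ball z 1, ‖d x‖ₑ ^ (3 : ℕ) = 0 := by
          intro x hx
          have hxR : ¬ R₀ ≤ ‖x‖ := by
            rw [mem_ball, dist_eq_norm] at hx
            intro hle
            apply hz
            have : ‖x‖ - ‖z‖ ≤ ‖x - z‖ := norm_sub_norm_le x z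
            linarith
          have h := hdle x
          rw [indicator_of_notMem (show x ∉ {y : EuclideanSpace ℝ (Fin 3) | R₀ ≤ ‖y‖} from hxR)] at h
          rw [le_zero_iff.1 h, zero_pow three_ne_zero]
        rw [hμ, setLIntegral_congr_fun measurableSet_ball h0, lintegral_zero]
        exact zero_le
    have hed : eLpNorm d 3 μ ≤ e3 := by rw [heL]; exact hroot (hd3.trans hη₁)
    -- (b) the two correctors
    have heC : ∀ R, R₀ ≤ R → eLpNorm (CO k R) 3 μ ≤ e3 := fun R hR => by
      rw [heL]; exact hroot ((hsmall_corr k R hR z).trans hη₂)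
    -- (c) the triangle inequality
    have hdm : AEStronglyMeasurable d μ := hdcont.aestronglyMeasurable
    have hCm : ∀ R, 0 < R → AEStronglyMeasurable (CO k R) μ := fun R hR => (hCOcont k R hR).aestronglyMeasurable
    calc eLpNorm (α k) 3 μ = eLpNorm ((d - CO k (Rk k)) + CO k R₀) 3 μ := by rw [hαeq]
      _ ≤ eLpNorm (d - CO k (Rk k)) 3 μ + eLpNorm (CO k R₀) 3 μ :=
          eLpNorm_add_le (hdm.sub (hCm _ (hRkpos k))) (hCm R₀ hR₀pos) (by norm_num)
      _ ≤ (eLpNorm d 3 μ + eLpNorm (CO k (Rk k)) 3 μ) + eLpNorm (CO k R₀) 3 μ :=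
          add_le_add (eLpNorm_sub_le hdm (hCm _ (hRkpos k)) (by norm_num)) le_rfl
      _ ≤ (e3 + e3) + e3 := add_le_add (add_le_add hed (heC _ (hRk k))) (heC R₀ le_rfl)
      _ = ENNReal.ofReal ε := by
          rw [he3, ENNReal.div_add_div_same, ENNReal.div_add_div_same,
            show ENNReal.ofReal ε + ENNReal.ofReal ε + ENNReal.ofReal ε = ENNReal.ofReal ε * 3 by ring,
            ENNReal.mul_div_cancel_right (by norm_num) (by norm_num)]
  ------------------------------------------------------------------
  -- ## Step 5: the `β_k` are bounded in `L²` uniformly in `k`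
  ------------------------------------------------------------------
  · obtain ⟨K₂, hK₂t, hK₂⟩ := exists_lintegral_newtonCorrector_sq_le (R := R₀) hR₀pos
    obtain ⟨F', hF'⟩ := exists_finset_ball_subset_biUnion_ball_one (2 * R₀ + 1)
    -- uniform `L²` and `L¹` bounds of `ã_k` on `B(0, 2R₀ + 1)`
    set B₃ : ℝ≥0∞ := F₂.card * A with hB₃
    set B₂ : ℝ≥0∞ := F'.card * (V ^ (1 / 3 : ℝ) * B₃ ^ (2 / 3 : ℝ)) with hB₂
    set B₁ : ℝ≥0∞ := F'.card * (V ^ (2 / 3 : ℝ) * B₃ ^ (1 / 3 : ℝ)) with hB₁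
    have hB₃t : B₃ ≠ ⊤ := ENNReal.mul_ne_top (ENNReal.natCast_ne_top _) hAt
    have hB₂t : B₂ ≠ ⊤ := ENNReal.mul_ne_top (ENNReal.natCast_ne_top _) (ENNReal.mul_ne_top
      (ENNReal.rpow_ne_top_of_nonneg (by norm_num) hVt) (ENNReal.rpow_ne_top_of_nonneg (by norm_num) hB₃t))
    have hB₁t : B₁ ≠ ⊤ := ENNReal.mul_ne_top (ENNReal.natCast_ne_top _) (ENNReal.mul_ne_top
      (ENNReal.rpow_ne_top_of_nonneg (by norm_num) hVt) (ENNReal.rpow_ne_top_of_nonneg (by norm_num) hB₃t))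
    have hX₂ : ∀ k, ∫⁻ x in ball (0 : EuclideanSpace ℝ (Fin 3)) (2 * R₀ + 1), ‖at' k x‖ₑ ^ (2 : ℕ) ≤ B₂ := by
      intro k
      refine (lintegral_mono_set (hF' 0)).trans (lintegral_biUnion_finset_le_card_mul F' _ _ fun c _ => ?_)
      exact (lintegral_unitBall_sq_le_rpow_cube (hcont k).measurable.enorm.aemeasurable _).trans
        (mul_le_mul' le_rfl (ENNReal.rpow_le_rpow (hcubeA k _) (by norm_num)))
    have hX₁ : ∀ k, ∫⁻ x in ball (0 : EuclideanSpace ℝ (Fin 3)) (2 * R₀ + 1), ‖at' k x‖ₑ ≤ B₁ := by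
      intro k
      refine (lintegral_mono_set (hF' 0)).trans (lintegral_biUnion_finset_le_card_mul F' _ _ fun c _ => ?_)
      exact (lintegral_unitBall_le_rpow_cube (hcont k).measurable.enorm.aemeasurable _).trans
        (mul_le_mul' le_rfl (ENNReal.rpow_le_rpow (hcubeA k _) (by norm_num)))
    refine ⟨2 * B₂ + 2 * (K₂ * (B₂ + B₁ ^ (2 : ℕ))), ?_, fun k => ?_⟩
    · refine ENNReal.add_lt_top.2 ⟨ENNReal.mul_lt_top ENNReal.ofNat_lt_top hB₂t.lt_top, ENNReal.mul_lt_top ENNReal.ofNat_lt_top ?_⟩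
      exact ENNReal.mul_lt_top hK₂t (ENNReal.add_lt_top.2 ⟨hB₂t.lt_top, ENNReal.pow_lt_top hB₁t.lt_top⟩)
    -- `β_k = χ_{R₀} ã_k − CO_k`
    have hsq : ∀ p q : ℝ≥0∞, (p + q) ^ (2 : ℕ) ≤ 2 * p ^ (2 : ℕ) + 2 * q ^ (2 : ℕ) := fun p q => by
      have h := ENNReal.rpow_add_le_mul_rpow_add_rpow p q (by norm_num : (1 : ℝ) ≤ 2)
      have e2 : (2 : ℝ≥0∞) ^ ((2 : ℝ) - 1) = 2 := by
        rw [show (2 : ℝ) - 1 = ((1 : ℕ) : ℝ) by norm_num, ENNReal.rpow_natCast, pow_one]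
      have e3' : ∀ w : ℝ≥0∞, w ^ (2 : ℝ) = w ^ (2 : ℕ) := fun w => by
        rw [show (2 : ℝ) = ((2 : ℕ) : ℝ) by norm_num, ENNReal.rpow_natCast]
      simp only [e2, e3'] at h
      exact h.trans (le_of_eq (by ring))
    have hχ2 : ∫⁻ x, ‖cutoff (E := EuclideanSpace ℝ (Fin 3)) R₀ x • at' k x‖ₑ ^ (2 : ℕ) ≤ B₂ := by
      have hpt : ∀ x, ‖cutoff (E := EuclideanSpace ℝ (Fin 3)) R₀ x • at' k x‖ₑ ^ (2 : ℕ) ≤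
          (ball (0 : EuclideanSpace ℝ (Fin 3)) (2 * R₀ + 1)).indicator (fun x => ‖at' k x‖ₑ ^ (2 : ℕ)) x := by
        intro x
        by_cases hx : x ∈ ball (0 : EuclideanSpace ℝ (Fin 3)) (2 * R₀ + 1)
        · rw [indicator_of_mem hx, enorm_smul]
          refine pow_le_pow_left' (mul_le_of_le_one_left' ?_) 2
          rw [← ofReal_norm, Real.norm_eq_abs, ← ENNReal.ofReal_one]
          exact ENNReal.ofReal_le_ofReal (abs_cutoff_le_one _ _)
        · rw [indicator_of_notMem hx]
          rw [mem_ball_zero_iff, not_lt] at hx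
          rw [cutoff_eq_zero hR₀pos (by linarith), zero_smul, enorm_zero, zero_pow two_ne_zero]
      calc _ ≤ ∫⁻ x, (ball (0 : EuclideanSpace ℝ (Fin 3)) (2 * R₀ + 1)).indicator (fun x => ‖at' k x‖ₑ ^ (2 : ℕ)) x :=
            lintegral_mono hpt
        _ = ∫⁻ x in ball (0 : EuclideanSpace ℝ (Fin 3)) (2 * R₀ + 1), ‖at' k x‖ₑ ^ (2 : ℕ) := lintegral_indicator measurableSet_ball _
        _ ≤ B₂ := hX₂ k
    have hC2 : ∫⁻ x, ‖CO k R₀ x‖ₑ ^ (2 : ℕ) ≤ K₂ * (B₂ + B₁ ^ (2 : ℕ)) := by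
      refine (hK₂ (at' k) (hC1 k)).trans ?_
      gcongr
      · exact hX₂ k
      · exact hX₁ k
    have hm1 : AEMeasurable (fun x => ‖cutoff (E := EuclideanSpace ℝ (Fin 3)) R₀ x • at' k x‖ₑ ^ (2 : ℕ)) volume :=
      (((contDiff_cutoff (n := 0) R₀).continuous.smul (hcont k)).measurable.enorm.pow_const _).aemeasurable
    calc ∫⁻ x, ‖β k x‖ₑ ^ (2 : ℕ)
        ≤ ∫⁻ x, (2 * ‖cutoff (E := EuclideanSpace ℝ (Fin 3)) R₀ x • at' k x‖ₑ ^ (2 : ℕ) + 2 * ‖CO k R₀ x‖ₑ ^ (2 : ℕ)) := by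
          refine lintegral_mono fun x => ?_
          have e : β k x = cutoff (E := EuclideanSpace ℝ (Fin 3)) R₀ x • at' k x - CO k R₀ x := rfl
          rw [e]
          exact (pow_le_pow_left' (enorm_sub_le) 2).trans (hsq _ _)
      _ = 2 * (∫⁻ x, ‖cutoff (E := EuclideanSpace ℝ (Fin 3)) R₀ x • at' k x‖ₑ ^ (2 : ℕ)) + 2 * ∫⁻ x, ‖CO k R₀ x‖ₑ ^ (2 : ℕ) := by
          rw [lintegral_add_left' (hm1.const_mul _), lintegral_const_mul' _ _ ENNReal.ofNat_ne_top,
            lintegral_const_mul' _ _ ENNReal.ofNat_ne_top]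
      _ ≤ 2 * B₂ + 2 * (K₂ * (B₂ + B₁ ^ (2 : ℕ))) := by gcongr
  ------------------------------------------------------------------
  -- ## Step 6: `α_k + β_k → a` in `L²(B(0, ρ))`
  ------------------------------------------------------------------
  · intro ρ hρ
    obtain ⟨Fρ, hFρ⟩ := exists_finset_ball_subset_biUnion_ball_one ρ
    -- the decay moduli `s_k = sup_{‖c‖ ≥ R_k - 4} ∫_{B(c,1)} |a|³ → 0`
    set sk : ℕ → ℝ≥0∞ := fun k => ⨆ (c : EuclideanSpace ℝ (Fin 3)) (_ : Rk k - 4 ≤ ‖c‖),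
      ∫⁻ x in ball c 1, ‖a x‖ₑ ^ (3 : ℕ) with hsk
    have hsk_bound : ∀ k (c : EuclideanSpace ℝ (Fin 3)), Rk k - 4 ≤ ‖c‖ → ∫⁻ x in ball c 1, ‖a x‖ₑ ^ (3 : ℕ) ≤ sk k :=
      fun k c hc => le_iSup₂ (f := fun (c : EuclideanSpace ℝ (Fin 3)) (_ : Rk k - 4 ≤ ‖c‖) => ∫⁻ x in ball c 1, ‖a x‖ₑ ^ (3 : ℕ)) c hc
    have hsk_lim : Tendsto sk atTop (𝓝 0) := by
      rw [ENNReal.tendsto_atTop_zero]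
      intro η hη
      obtain ⟨r, -, hr⟩ := exists_radius_forall_lintegral_ball_le_of_tendsto_cocompact hdecay hη
      obtain ⟨N, hN⟩ := exists_nat_gt r
      refine ⟨N, fun k hk => iSup₂_le fun c hc => hr c ?_⟩
      have : (N : ℝ) ≤ k := by exact_mod_cast hk
      have hc' : R₀ + ((k : ℝ) + 1) - 4 ≤ ‖c‖ := hc
      linarith
    -- the corrector part on `B(0, ρ)` is controlled by `s_k`
    have hcorr : ∀ k, ∫⁻ x in ball (0 : EuclideanSpace ℝ (Fin 3)) ρ, ‖CO k (Rk k) x‖ₑ ^ (2 : ℕ) ≤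
        Fρ.card * (V ^ (1 / 3 : ℝ) * (K₁ * (F₂.card * sk k)) ^ (2 / 3 : ℝ)) := by
      intro k
      have hunif : ∀ z : EuclideanSpace ℝ (Fin 3), ∫⁻ x in ball z 1, ‖CO k (Rk k) x‖ₑ ^ (3 : ℕ) ≤ K₁ * (F₂.card * sk k) := by
        intro z
        refine hK₁ (at' k) (Rk k) (F₂.card * sk k) (hC1 k) (hR₀1.trans (hRk k)) (fun c hc => ?_) z
        exact hcubeDecay k (r := Rk k - 4) (hsk_bound k) c (by linarith)
      refine (lintegral_mono_set (hFρ 0)).trans (lintegral_biUnion_finset_le_card_mul Fρ _ _ fun c _ => ?_)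
      exact (lintegral_unitBall_sq_le_rpow_cube (hCOcont k _ (hRkpos k)).measurable.enorm.aemeasurable _).trans
        (mul_le_mul' le_rfl (ENNReal.rpow_le_rpow (hunif _) (by norm_num)))
    have hcorr_lim : Tendsto (fun k => (Fρ.card : ℝ≥0∞) * (V ^ (1 / 3 : ℝ) * (K₁ * (F₂.card * sk k)) ^ (2 / 3 : ℝ))) atTop (𝓝 0) := by
      have h1 : Tendsto (fun k => K₁ * (F₂.card * sk k)) atTop (𝓝 0) := by
        have h := ENNReal.Tendsto.const_mul hsk_lim (a := K₁ * F₂.card) (Or.inr (ENNReal.mul_ne_top hK₁t.ne (ENNReal.natCast_ne_top _)))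
        rw [mul_zero] at h
        simpa only [mul_assoc] using h
      have h2 : Tendsto (fun k => (K₁ * (F₂.card * sk k)) ^ (2 / 3 : ℝ)) atTop (𝓝 0) := by
        have h := ((ENNReal.continuous_rpow_const (y := (2 / 3 : ℝ))).tendsto 0).comp h1
        rwa [ENNReal.zero_rpow_of_pos (by norm_num)] at h
      have h3 : Tendsto (fun k => V ^ (1 / 3 : ℝ) * (K₁ * (F₂.card * sk k)) ^ (2 / 3 : ℝ)) atTop (𝓝 0) := by
        have h := ENNReal.Tendsto.const_mul h2 (a := V ^ (1 / 3 : ℝ)) (Or.inr (ENNReal.rpow_ne_top_of_nonneg (by norm_num) hVt))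
        rwa [mul_zero] at h
      have h := ENNReal.Tendsto.const_mul h3 (a := (Fρ.card : ℝ≥0∞)) (Or.inr (ENNReal.natCast_ne_top _))
      rwa [mul_zero] at h
    -- the mollification part
    have hmoll := tendsto_lintegral_ball_normed_convolution_sub_sq hφlim hφ1 ham hAt hA ρ
    -- for large `k`, `R_k ≥ ρ` and the cut-off is `1` on `B(0, ρ)`
    obtain ⟨k₀, hk₀⟩ := exists_nat_gt ρ
    have hsq : ∀ p q : ℝ≥0∞, (p + q) ^ (2 : ℕ) ≤ 2 * p ^ (2 : ℕ) + 2 * q ^ (2 : ℕ) := fun p q => by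
      have h := ENNReal.rpow_add_le_mul_rpow_add_rpow p q (by norm_num : (1 : ℝ) ≤ 2)
      have e2 : (2 : ℝ≥0∞) ^ ((2 : ℝ) - 1) = 2 := by
        rw [show (2 : ℝ) - 1 = ((1 : ℕ) : ℝ) by norm_num, ENNReal.rpow_natCast, pow_one]
      have e3' : ∀ w : ℝ≥0∞, w ^ (2 : ℝ) = w ^ (2 : ℕ) := fun w => by
        rw [show (2 : ℝ) = ((2 : ℕ) : ℝ) by norm_num, ENNReal.rpow_natCast]
      simp only [e2, e3'] at h
      exact h.trans (le_of_eq (by ring))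
    have hbound : ∀ k, k₀ ≤ k → ∫⁻ x in ball (0 : EuclideanSpace ℝ (Fin 3)) ρ, ‖α k x + β k x - a x‖ₑ ^ (2 : ℕ) ≤
        2 * (∫⁻ x in ball (0 : EuclideanSpace ℝ (Fin 3)) ρ, ‖at' k x - a x‖ₑ ^ 2) +
          2 * (Fρ.card * (V ^ (1 / 3 : ℝ) * (K₁ * (F₂.card * sk k)) ^ (2 / 3 : ℝ))) := by
      intro k hk
      have hRkρ : ρ ≤ Rk k := by
        have : (k₀ : ℝ) ≤ k := by exact_mod_cast hk
        show ρ ≤ R₀ + ((k : ℝ) + 1)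
        linarith
      have hpt : ∀ x ∈ ball (0 : EuclideanSpace ℝ (Fin 3)) ρ, ‖α k x + β k x - a x‖ₑ ^ (2 : ℕ) ≤
          2 * ‖at' k x - a x‖ₑ ^ 2 + 2 * ‖CO k (Rk k) x‖ₑ ^ (2 : ℕ) := by
        intro x hx
        have hχ : cutoff (E := EuclideanSpace ℝ (Fin 3)) (Rk k) x = 1 :=
          cutoff_eq_one (hRkpos k) ((mem_ball_zero_iff.1 hx).le.trans hRkρ)
        have e : α k x + β k x - a x = (at' k x - a x) - CO k (Rk k) x := by
          have h1 : α k x + β k x = TR k (Rk k) x := by rw [← Pi.add_apply, hαβ]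
          rw [h1]
          simp only [hTR, hCO, hχ, one_smul]
          abel
        rw [e]
        exact (pow_le_pow_left' (enorm_sub_le) 2).trans (hsq _ _)
      have hm : AEMeasurable (fun x => 2 * ‖at' k x - a x‖ₑ ^ 2) (volume.restrict (ball (0 : EuclideanSpace ℝ (Fin 3)) ρ)) :=
        ((((hcont k).aestronglyMeasurable.sub ham).enorm.pow_const _).const_mul _).restrict
      calc ∫⁻ x in ball (0 : EuclideanSpace ℝ (Fin 3)) ρ, ‖α k x + β k x - a x‖ₑ ^ (2 : ℕ)
          ≤ ∫⁻ x in ball (0 : EuclideanSpace ℝ (Fin 3)) ρ, (2 * ‖at' k x - a x‖ₑ ^ 2 + 2 * ‖CO k (Rk k) x‖ₑ ^ (2 : ℕ)) :=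
            setLIntegral_mono' measurableSet_ball hpt
        _ = 2 * (∫⁻ x in ball (0 : EuclideanSpace ℝ (Fin 3)) ρ, ‖at' k x - a x‖ₑ ^ 2) +
            2 * ∫⁻ x in ball (0 : EuclideanSpace ℝ (Fin 3)) ρ, ‖CO k (Rk k) x‖ₑ ^ (2 : ℕ) := by
            rw [lintegral_add_left' hm, lintegral_const_mul' _ _ ENNReal.ofNat_ne_top, lintegral_const_mul' _ _ ENNReal.ofNat_ne_top]
        _ ≤ _ := by gcongr; exact hcorr k
    have hlim : Tendsto (fun k => 2 * (∫⁻ x in ball (0 : EuclideanSpace ℝ (Fin 3)) ρ, ‖at' k x - a x‖ₑ ^ 2) +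
        2 * (Fρ.card * (V ^ (1 / 3 : ℝ) * (K₁ * (F₂.card * sk k)) ^ (2 / 3 : ℝ)))) atTop (𝓝 0) := by
      have h1 := ENNReal.Tendsto.const_mul hmoll (a := 2) (Or.inr ENNReal.ofNat_ne_top)
      have h2 := ENNReal.Tendsto.const_mul hcorr_lim (a := 2) (Or.inr ENNReal.ofNat_ne_top)
      rw [mul_zero] at h1 h2
      simpa using h1.add h2
    refine tendsto_of_tendsto_of_tendsto_of_le_of_le' tendsto_const_nhds hlim (Eventually.of_forall fun _ => zero_le) ?_
    exact (eventually_ge_atTop k₀).mono fun k hk => hbound k hk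

end Splitting

end Literature.Analysis.FluidPDE
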